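import Mathlib.Analysis.SpecialFunctions.Pow.Real
import Mathlib.Analysis.Complex.ExponentialBounds
import Mathlib.Algebra.MvPolynomial.PDeriv
import Mathlib.LinearAlgebra.Dimension.Constructions
import Mathlib.LinearAlgebra.FiniteDimensional.Defs
import Mathlib.Data.Finsupp.Weight
import Mathlib.Data.Finsupp.Multiset
import Mathlib.Data.Finsupp.Fin
import Mathlib.Data.Fintype.Vector
import Mathlib.Data.Nat.Choose.Vandermonde
import Mathlib.Data.Nat.Choose.Bounds
import Mathlib.Data.Nat.Choose.Sum
import Mathlib.Data.Sym.Card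
import Literature.Computability.AlgebraicComplexity.GKKSDepthFour
import HarnessLib

/-!
# Proof of the Gupta–Kamath–Kayal–Saptharishi depth-four lower bound (`gkks_depth4_holds`)

Discharge of the named fact `gkks_depth4` (`GKKSDepthFour.lean`): over any field (the fact asks
only for characteristic `0`), for every `c₀` there are `ε > 0` and `n₀` such that for `n ≥ n₀`
every `ΣΠ^{[c₀⌊√n⌋]}ΣΠ^{[⌊√n⌋]}` expression `per_n = ∑_{i<s} ∏_{j<D} Q_{ij}` (or `det_n = …`)
has `2^{ε√n} ≤ s` [Gupta–Kamath–Kayal–Saptharishi, J. ACM 61 (2014), Thm. 2 = CCC 2013].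

We follow the architecture of the printed proof (the method of SHIFTED PARTIAL DERIVATIVES,
op. cit. §2, Def. 1) with a self-contained, slightly simplified lower-bound count:

* §1 `iterPderiv`: iterated formal partial derivatives along a list of variables; the value on a
  monomial (`iterPderiv_monomial`), degree drop (`totalDegree_pderiv_succ_le`), Leibniz over
  finite products (`pderiv_finset_prod`).
* §2 Upper bound (op. cit. Prop. 9 / Cor. 10): a `k`-th order derivative of `∏_{j<D} Q_j` with
  `deg Q_j ≤ t` lies in `span {(∏_{j ∉ A} Q_j) · g : |A| ≤ k, deg g ≤ |A| t - k}`
  (`iterPderiv_prod_mem`), whence the shifted-partials space of `∑_{i<s} ∏_j Q_{ij}` has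
  dimension `≤ s · #{A ⊆ [D] : |A| ≤ k} · #{monomials of degree ≤ ℓ + k(t-1)}`
  (`finrank_shifted_le`).
* §3 Counting monomials: `#{β : σ →₀ ℕ, |β| ≤ L} = C(|σ| + L, L)` (`card_degLE`).
* §4 Lower bound for `f = ∑_σ c_σ ∏ᵢ X_{σ i, i}` (all `c_σ ≠ 0`; `per_n`: `c = 1`, `det_n`:
  `c = sign`), op. cit. §5: derivatives with respect to `k` variables in distinct rows and columns
  are (signed) minors; instead of leading monomials under a lexicographic order (Cor. 12/13) we
  use the WEIGHT "number of variables on the two diagonals `D₂ = {x_{ii}} ∪ {x_{i,i+1}}`"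
  (Lemma 14 restricts to `D₂` as well): among the bijections pairing the remaining columns with
  the remaining rows only the increasing one uses `D₂`-cells exclusively (a path has at most one
  perfect matching, `eq_sigma0_of_diag`), so each shifted minor has a unique maximal-weight
  monomial; an explicit block family of `(n-k)`-increasing sequences of size `h^{2k}`,
  `h ≈ n/(2k)` (in place of Lemma 15's exact count `C(n+k,2k)`), the "companions" device of
  Lemma 14 (shifts may use all but `2k` variables) and a greedy decoding give distinct pivots,
  hence linear independence (`finrank_shifted_ge`).
* §5 Numerics (op. cit. §6 with `t = ⌊√n⌋`, `ℓ = n²t`, `k = ⌊t/M⌋`, `M = 2600(c₀+1)`):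
  elementary ratio estimates for binomial coefficients replace the Stirling-type Claim 17; the
  outcome is `s ≥ 4^k ≥ 2^{√n/M}` for `n ≥ 4M²` (`numeric`).
* §6 Assembly: `gkks_depth4_holds`.

Nothing here is a new named fact; all intermediate results are proved (D-0026).

## References

* A. Gupta, P. Kamath, N. Kayal, R. Saptharishi, *Approaching the chasm at depth four*,
  J. ACM 61 (2014), no. 6, Art. 33 (CCC 2013; ECCC TR12-098): Def. 1, Prop. 8–9, Cor. 10,
  Prop. 11, Cor. 12–13, Lemma 14–15, Cor. 16, Thm. 2/3 and §6, §8 (determinant).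
-/

noncomputable section

open MvPolynomial

namespace Literature.Computability.AlgebraicComplexity.GKKS

/-! ## §1 Iterated partial derivatives -/

section Deriv

variable {K : Type*} [CommRing K] {σ : Type*}

/-- Iterated formal partial derivative `∂_L = ∂_{v₁} ∘ ∂_{v₂} ∘ ⋯ ∘ ∂_{v_r}` along a list of
variables `L = [v₁, …, v_r]`, as a `K`-linear map (GKKS 2014, §2: `∂^{j} f`). [folklore] -/
def iterPderiv : List σ → (MvPolynomial σ K →ₗ[K] MvPolynomial σ K)
  | [] => LinearMap.id
  | v :: L => (pderiv v : Derivation K (MvPolynomial σ K) (MvPolynomial σ K)).toLinearMap.comp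
      (iterPderiv L)

/-- `∂_{[]} p = p`. [folklore] -/
@[simp] theorem iterPderiv_nil (p : MvPolynomial σ K) : iterPderiv [] p = p := rfl

/-- `∂_{v :: L} p = ∂_v (∂_L p)`. [folklore] -/
@[simp] theorem iterPderiv_cons (v : σ) (L : List σ) (p : MvPolynomial σ K) :
    iterPderiv (v :: L) p = pderiv v (iterPderiv L p) := rfl

/-- The indicator exponent vector `∑_{v ∈ L} e_v` of a list of variables. [folklore] -/
def listInd : List σ → (σ →₀ ℕ)
  | [] => 0
  | v :: L => Finsupp.single v 1 + listInd L

/-- `listInd [] = 0`. [folklore] -/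
@[simp] theorem listInd_nil : listInd ([] : List σ) = 0 := rfl

/-- `listInd (v :: L) = e_v + listInd L`. [folklore] -/
@[simp] theorem listInd_cons (v : σ) (L : List σ) :
    listInd (v :: L) = Finsupp.single v 1 + listInd L := rfl

/-- A variable not in the list has exponent `0` in its indicator. [folklore] -/
theorem listInd_apply_of_not_mem {L : List σ} {v : σ} (hv : v ∉ L) : listInd L v = 0 := by
  classical
  induction L with
  | nil => simp
  | cons w L ih =>
    simp only [List.mem_cons, not_or] at hv
    simp [Ne.symm hv.1, ih hv.2]

/-- A variable occurring in a duplicate-free list has exponent `1` in its indicator. [folklore] -/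
theorem listInd_apply_of_mem {L : List σ} (hL : L.Nodup) {v : σ} (hv : v ∈ L) :
    listInd L v = 1 := by
  classical
  induction L with
  | nil => simp at hv
  | cons w L ih =>
    rw [List.nodup_cons] at hL
    simp only [List.mem_cons] at hv
    rcases hv with rfl | hv
    · simp [listInd_apply_of_not_mem hL.1]
    · have hne : w ≠ v := fun h => hL.1 (h ▸ hv)
      simp [hne, ih hL.2 hv]

/-- **Iterated derivative of a monomial** along distinct variables:
`∂_L (a x^s) = (a ∏_{v∈L} s_v) x^{s - 1_L}`. [folklore] -/
theorem iterPderiv_monomial (L : List σ) (hL : L.Nodup) (s : σ →₀ ℕ) (a : K) :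
    iterPderiv L (monomial s a) =
      monomial (s - listInd L) (a * (L.map fun v => (s v : K)).prod) := by
  induction L with
  | nil => simp
  | cons v L ih =>
    rw [List.nodup_cons] at hL
    rw [iterPderiv_cons, ih hL.2, pderiv_monomial]
    have hv : (s - listInd L) v = s v := by
      rw [Finsupp.tsub_apply, listInd_apply_of_not_mem hL.1, tsub_zero]
    rw [hv, listInd_cons, add_comm (Finsupp.single v 1), ← tsub_tsub]
    congr 1
    simp only [List.map_cons, List.prod_cons]
    ring

/-- The indicator of `List.ofFn g` is `∑_j e_{g j}`. [folklore] -/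
theorem listInd_ofFn {m : ℕ} (g : Fin m → σ) :
    listInd (List.ofFn g) = ∑ j, Finsupp.single (g j) 1 := by
  induction m with
  | zero => simp
  | succ m ih => rw [List.ofFn_succ, listInd_cons, ih, Fin.sum_univ_succ]

/-- **Triangular criterion for linear independence**: if each `v_i` has a "pivot" functional
`φ_i` with `φ_i (v_i) ≠ 0` and `φ_i (v_j) = 0` whenever `j ≠ i` has height `≤` that of `i`,
the family is linearly independent (Gaussian elimination; GKKS 2014, Prop. 11). [cite: GuptaKamathKayalSaptharishi2014, Prop. 11] -/
theorem linearIndependent_of_triangular {F V ι : Type*} [Field F] [AddCommGroup V] [Module F V]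
    (v : ι → V) (φ : ι → V →ₗ[F] F) (ht : ι → ℕ) (h1 : ∀ i, φ i (v i) ≠ 0)
    (h2 : ∀ i j, i ≠ j → ht j ≤ ht i → φ i (v j) = 0) : LinearIndependent F v := by
  classical
  rw [linearIndependent_iff']
  intro s g hg
  by_contra hne
  push Not at hne
  obtain ⟨i0, hi0s, hi0⟩ := hne
  obtain ⟨i, hiT, hmax⟩ := Finset.exists_max_image (s.filter fun i => g i ≠ 0) ht
    ⟨i0, Finset.mem_filter.2 ⟨hi0s, hi0⟩⟩
  rw [Finset.mem_filter] at hiT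
  have key := congrArg (φ i) hg
  rw [map_sum, map_zero, Finset.sum_eq_single i] at key
  · rw [map_smul, smul_eq_mul] at key
    exact hiT.2 ((mul_eq_zero.1 key).resolve_right (h1 i))
  · intro j hjs hji
    rw [map_smul, smul_eq_mul]
    by_cases hgj : g j = 0
    · rw [hgj, zero_mul]
    · rw [h2 i j (Ne.symm hji) (hmax j (Finset.mem_filter.2 ⟨hjs, hgj⟩)), mul_zero]
  · intro hi; exact absurd hiT.1 hi

/-- Greedy (leftmost) selection of pairwise non-adjacent positions from `U ⊆ ℕ`: position `p`
is selected iff `p ∈ U` and `p - 1` was not selected. [folklore] -/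
def greedy (U : ℕ → Prop) : ℕ → Prop
  | 0 => U 0
  | p + 1 => U (p + 1) ∧ ¬ greedy U p

/-- **Greedy decoding** (the "leading increasing sequence" of GKKS 2014, Lemma 14): if
`Q ⊆ U ⊆ Q ∪ (Q + 1)` and `Q` has no two adjacent positions, the greedy selection from `U`
recovers `Q`. [cite: GuptaKamathKayalSaptharishi2014, Lemma 14] -/
theorem greedy_iff (U Q : ℕ → Prop) (h1 : ∀ p, Q p → U p)
    (h2 : ∀ p, U p → Q p ∨ (1 ≤ p ∧ Q (p - 1))) (h3 : ∀ p, Q p → ¬ Q (p + 1)) :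
    ∀ p, greedy U p ↔ Q p := by
  intro p
  induction p with
  | zero =>
    simp only [greedy]
    refine ⟨fun h => ?_, h1 0⟩
    rcases h2 0 h with h' | ⟨h', -⟩
    · exact h'
    · omega
  | succ p ih =>
    simp only [greedy, ih]
    refine ⟨fun ⟨hU, hQ⟩ => ?_, fun h => ⟨h1 _ h, fun hp => h3 p hp h⟩⟩
    rcases h2 _ hU with h' | ⟨-, h'⟩
    · exact h'
    · exact absurd (by simpa using h') hQ

/-- A non-zero partial derivative has total degree at least one less. [folklore] -/
theorem totalDegree_pderiv_succ_le {i : σ} {F : MvPolynomial σ K} (h : pderiv i F ≠ 0) :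
    (pderiv i F).totalDegree + 1 ≤ F.totalDegree := by
  have hne : (pderiv i F).support.Nonempty := MvPolynomial.support_nonempty.2 h
  obtain ⟨m, hm, hmax⟩ :=
    Finset.exists_mem_eq_sup _ hne (fun s : σ →₀ ℕ => s.sum fun _ e => e)
  rw [MvPolynomial.totalDegree, hmax]
  have hc : MvPolynomial.coeff m (pderiv i F) ≠ 0 := MvPolynomial.mem_support_iff.1 hm
  rw [coeff_pderiv] at hc
  have hc' : MvPolynomial.coeff (m + Finsupp.single i 1) F ≠ 0 := fun h0 => hc (by
    rw [h0, zero_mul])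
  have hle := le_totalDegree (MvPolynomial.mem_support_iff.2 hc')
  rw [Finsupp.sum_add_index' (fun _ => rfl) (fun _ _ _ => rfl), Finsupp.sum_single_index rfl]
    at hle
  omega

/-- **Leibniz rule over a finite product**: `∂ (∏_{j∈s} Q_j) = ∑_{j∈s} (∏_{j'≠j} Q_{j'}) ∂ Q_j`.
[folklore] -/
theorem pderiv_finset_prod {ι : Type*} [DecidableEq ι] (i : σ) (s : Finset ι)
    (Q : ι → MvPolynomial σ K) :
    pderiv i (∏ j ∈ s, Q j) = ∑ j ∈ s, (∏ j' ∈ s.erase j, Q j') * pderiv i (Q j) := by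
  induction s using Finset.induction_on with
  | empty => simp
  | insert a s ha ih =>
    rw [Finset.prod_insert ha, pderiv_mul, ih, Finset.sum_insert ha, Finset.erase_insert ha,
      Finset.mul_sum]
    congr 1
    · ring
    · refine Finset.sum_congr rfl fun j hj => ?_
      have hne : a ≠ j := fun h => ha (h ▸ hj)
      rw [Finset.erase_insert_of_ne hne,
        Finset.prod_insert (fun h => ha (Finset.mem_of_mem_erase h))]
      ring

/-! ## §2 The upper bound for products of low-degree polynomials (GKKS 2014, Prop. 9) -/

/-- The span `⟨(∏_{j ∉ A} Q_j) · g : |A| ≤ r, deg g + r ≤ |A|·t⟩` containing all `r`-th order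
derivatives of `∏_j Q_j` when `deg Q_j ≤ t` (GKKS 2014, proof of Prop. 9). [cite: GuptaKamathKayalSaptharishi2014, Prop. 9] -/
def prodSpan {D : ℕ} (Q : Fin D → MvPolynomial σ K) (t r : ℕ) : Submodule K (MvPolynomial σ K) :=
  Submodule.span K {p | ∃ (A : Finset (Fin D)) (g : MvPolynomial σ K),
    A.card ≤ r ∧ g.totalDegree + r ≤ A.card * t ∧ p = (∏ j ∈ Aᶜ, Q j) * g}

/-- **GKKS 2014, Prop. 9 (engine)**: every `r`-th order partial derivative of `∏_{j<D} Q_j`,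
`deg Q_j ≤ t`, is a combination of products `(∏_{j∉A} Q_j) · g` with `|A| ≤ r` and
`deg g ≤ |A| t - r`. [cite: GuptaKamathKayalSaptharishi2014, Prop. 9] -/
theorem iterPderiv_prod_mem {D t : ℕ} (Q : Fin D → MvPolynomial σ K)
    (hQ : ∀ j, (Q j).totalDegree ≤ t) (L : List σ) :
    iterPderiv L (∏ j, Q j) ∈ prodSpan Q t L.length := by
  induction L with
  | nil =>
    refine Submodule.subset_span ⟨∅, 1, by simp, by simp, ?_⟩
    simp
  | cons v L ih =>
    rw [iterPderiv_cons]
    have key : prodSpan Q t L.length ≤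
        (prodSpan Q t (v :: L).length).comap
          (pderiv v : Derivation K (MvPolynomial σ K) (MvPolynomial σ K)).toLinearMap := by
      refine Submodule.span_le.mpr ?_
      rintro p ⟨A, g, hA, hg, rfl⟩
      simp only [List.length_cons, SetLike.mem_coe, Submodule.mem_comap, Derivation.coeFn_coe]
      rw [pderiv_mul, pderiv_finset_prod, Finset.sum_mul]
      refine add_mem (Submodule.sum_mem _ fun j0 hj0 => ?_) ?_
      · by_cases h0 : pderiv v (Q j0) = 0
        · simp [h0]
        have hj0A : j0 ∉ A := Finset.mem_compl.1 hj0
        have hdeg := totalDegree_pderiv_succ_le h0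
        refine Submodule.subset_span ⟨insert j0 A, pderiv v (Q j0) * g, ?_, ?_, ?_⟩
        · rw [Finset.card_insert_of_notMem hj0A]; omega
        · rw [Finset.card_insert_of_notMem hj0A]
          have h1 := totalDegree_mul (pderiv v (Q j0)) g
          have h2 := hQ j0
          have h3 : (A.card + 1) * t = A.card * t + t := by ring
          omega
        · rw [Finset.compl_insert, mul_assoc]
      · by_cases h0 : pderiv v g = 0
        · simp [h0]
        have hdeg := totalDegree_pderiv_succ_le h0
        exact Submodule.subset_span ⟨A, pderiv v g, by omega, by omega, rfl⟩
    exact key ih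

end Deriv

/-! ## §3 Monomials of bounded degree and the dimension upper bound (GKKS 2014, Cor. 10) -/

section Count

/-- The finite set of exponent vectors `β : σ →₀ ℕ` of degree `|β| ≤ L`. [folklore] -/
def degLE (σ : Type*) [Finite σ] (L : ℕ) : Finset (σ →₀ ℕ) :=
  (Finsupp.finite_of_degree_le (σ := σ) L).toFinset

/-- Membership in `degLE`. [folklore] -/
@[simp] theorem mem_degLE {σ : Type*} [Finite σ] {L : ℕ} {β : σ →₀ ℕ} :
    β ∈ degLE σ L ↔ β.degree ≤ L := by
  simp [degLE]

/-- `Finsupp.degree` is the sum of the exponents (the form used by `MvPolynomial.totalDegree`).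
[folklore] -/
theorem degree_eq_sum_id {σ : Type*} (β : σ →₀ ℕ) : β.degree = β.sum fun _ e => e := by
  simp [Finsupp.degree_apply, Finsupp.sum]

/-- `Finsupp.degree` is the sum of the exponents (the form used by `Sym.equivNatSum`).
[folklore] -/
theorem sum_id_eq_degree {σ : Type*} (β : σ →₀ ℕ) : (β.sum fun _ => id) = β.degree := by
  simp [Finsupp.degree_apply, Finsupp.sum]

/-- Exponents of a polynomial have degree at most its total degree. [folklore] -/
theorem degree_le_totalDegree {K : Type*} [CommSemiring K] {σ : Type*} {g : MvPolynomial σ K}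
    {β : σ →₀ ℕ} (h : β ∈ g.support) : β.degree ≤ g.totalDegree := by
  rw [degree_eq_sum_id]; exact le_totalDegree h

/-- `degLE (Fin M) L` is in bijection with the `L`-th symmetric power of `Fin (M+1)`
(slack variable). [folklore] -/
def degLEFinEquivSym (M L : ℕ) : (degLE (Fin M) L) ≃ Sym (Fin (M + 1)) L :=
  have hdeg : ∀ (y : ℕ) (s : Fin M →₀ ℕ), (Finsupp.cons y s).degree = y + s.degree := by
    intro y s
    rw [Finsupp.degree_eq_sum, Finsupp.degree_eq_sum, Fin.sum_univ_succ]
    simp [Finsupp.cons_zero, Finsupp.cons_succ]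
  have htail : ∀ (P : Fin (M + 1) →₀ ℕ), P.degree = P 0 + (Finsupp.tail P).degree := by
    intro P
    conv_lhs => rw [← Finsupp.cons_tail P]
    rw [hdeg]
  { toFun := fun β => (Sym.equivNatSum (Fin (M + 1)) L).symm
      ⟨Finsupp.cons (L - (β : Fin M →₀ ℕ).degree) β, by
        rw [sum_id_eq_degree, hdeg]
        have := mem_degLE.1 β.2
        omega⟩
    invFun := fun S => ⟨Finsupp.tail (Sym.equivNatSum (Fin (M + 1)) L S : Fin (M + 1) →₀ ℕ), by
        rw [mem_degLE]
        have h1 := (Sym.equivNatSum (Fin (M + 1)) L S).2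
        rw [sum_id_eq_degree, htail] at h1
        omega⟩
    left_inv := by
      rintro ⟨β, hβ⟩
      simp
    right_inv := by
      intro S
      apply (Sym.equivNatSum (Fin (M + 1)) L).injective
      rw [Equiv.apply_symm_apply]
      apply Subtype.ext
      have h1 : ((Sym.equivNatSum (Fin (M + 1)) L S : Fin (M + 1) →₀ ℕ)).degree = L := by
        rw [← sum_id_eq_degree]; exact (Sym.equivNatSum (Fin (M + 1)) L S).2
      have h2 := htail ((Sym.equivNatSum (Fin (M + 1)) L S : Fin (M + 1) →₀ ℕ))
      have h3 : L - (Finsupp.tail ((Sym.equivNatSum (Fin (M + 1)) L S : Fin (M + 1) →₀ ℕ))).degree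
          = ((Sym.equivNatSum (Fin (M + 1)) L S : Fin (M + 1) →₀ ℕ)) 0 := by omega
      simp only [h3, Finsupp.cons_tail] }

/-- **Stars and bars**: the number of monomials of degree `≤ L` in `M` variables is
`C(M + L, L)`. [folklore] -/
theorem card_degLE_fin (M L : ℕ) : (degLE (Fin M) L).card = (M + L).choose L := by
  rw [← Fintype.card_coe, Fintype.card_congr (degLEFinEquivSym M L), Sym.card_sym_eq_choose,
    Fintype.card_fin]
  congr 1
  omega

/-- The number of monomials of degree `≤ L` over a finite variable type `σ` is
`C(|σ| + L, L)`. [folklore] -/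
theorem card_degLE (σ : Type*) [Fintype σ] (L : ℕ) :
    (degLE σ L).card = (Fintype.card σ + L).choose L := by
  classical
  rw [← card_degLE_fin, ← Fintype.card_coe, ← Fintype.card_coe]
  refine Fintype.card_congr ((Finsupp.equivCongrLeft (Fintype.equivFin σ)).subtypeEquiv ?_)
  intro β
  rw [mem_degLE, mem_degLE, Finsupp.equivCongrLeft_apply, Finsupp.equivMapDomain_eq_mapDomain,
    Finsupp.degree_mapDomain]

variable {K : Type*} [Field K] {σ : Type*} [Fintype σ] [DecidableEq σ]

/-- The **shifted-partials space** `⟨x^γ · ∂_{L_i} f : i ∈ ι, |γ| ≤ ℓ⟩` of `f` for a family of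
derivative operators `(∂_{L_i})_{i ∈ ι}` (GKKS 2014, Def. 1, restricted to a sub-family of the
`k`-th order derivatives — lower bounds for it are lower bounds for the full space, and the upper
bound of Cor. 10 holds operator by operator). [cite: GuptaKamathKayalSaptharishi2014, Def. 1] -/
def shifted {ι : Type*} (Ls : ι → List σ) (ℓ : ℕ) (f : MvPolynomial σ K) :
    Submodule K (MvPolynomial σ K) :=
  Submodule.span K (Set.range fun p : ι × degLE σ ℓ =>
    monomial (p.2 : σ →₀ ℕ) 1 * iterPderiv (Ls p.1) f)

/-- The number of subsets of `Fin D` of size at most `k`. [folklore] -/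
def numSubsetsLE (D k : ℕ) : ℕ :=
  ((Finset.univ : Finset (Finset (Fin D))).filter fun A => A.card ≤ k).card

omit [DecidableEq σ] in
/-- **GKKS 2014, Cor. 10 (dimension upper bound)**: for `f = ∑_{i<s} ∏_{j<D} Q_{ij}` with
`deg Q_{ij} ≤ t` and any family of `k`-th order derivative operators, the shifted-partials space
has dimension `≤ s · #{A ⊆ [D] : |A| ≤ k} · #{β : |β| ≤ ℓ + k(t-1)}`. [cite: GuptaKamathKayalSaptharishi2014, Cor. 10] -/
theorem finrank_shifted_le {ι : Type*} [Fintype ι] (Ls : ι → List σ) (k : ℕ)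
    (hLs : ∀ i, (Ls i).length = k) {s D t ℓ : ℕ} (Q : Fin s → Fin D → MvPolynomial σ K)
    (hQ : ∀ i j, (Q i j).totalDegree ≤ t) :
    Module.finrank K (shifted Ls ℓ (∑ i, ∏ j, Q i j)) ≤
      s * numSubsetsLE D k * (degLE σ (ℓ + k * (t - 1))).card := by
  classical
  set w : Fin s × {A : Finset (Fin D) // A.card ≤ k} × degLE σ (ℓ + k * (t - 1)) →
      MvPolynomial σ K := fun q => monomial (q.2.2 : σ →₀ ℕ) 1 * ∏ j ∈ (q.2.1 : Finset (Fin D))ᶜ, Q q.1 j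
    with hw
  have hle : shifted Ls ℓ (∑ i, ∏ j, Q i j) ≤ Submodule.span K (Set.range w) := by
    refine Submodule.span_le.mpr ?_
    rintro _ ⟨⟨i, γ⟩, rfl⟩
    simp only [SetLike.mem_coe, map_sum, Finset.mul_sum]
    refine Submodule.sum_mem _ fun a _ => ?_
    have hmem : iterPderiv (Ls i) (∏ j, Q a j) ∈ prodSpan (Q a) t k :=
      hLs i ▸ iterPderiv_prod_mem (Q a) (hQ a) (Ls i)
    have key : prodSpan (Q a) t k ≤ (Submodule.span K (Set.range w)).comap
        (LinearMap.mulLeft K (monomial (γ : σ →₀ ℕ) (1 : K))) := by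
      refine Submodule.span_le.mpr ?_
      rintro p ⟨A, g, hA, hg, rfl⟩
      simp only [SetLike.mem_coe, Submodule.mem_comap, LinearMap.mulLeft_apply]
      rw [g.as_sum, Finset.mul_sum, Finset.mul_sum]
      refine Submodule.sum_mem _ fun β hβ => ?_
      have hβdeg : β.degree ≤ k * (t - 1) := by
        have h1 := degree_le_totalDegree hβ
        have h2 : A.card * t ≤ k * t := Nat.mul_le_mul_right t hA
        rw [Nat.mul_sub_one]
        omega
      have hγβ : (γ : σ →₀ ℕ) + β ∈ degLE σ (ℓ + k * (t - 1)) := by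
        rw [mem_degLE, map_add]
        exact add_le_add (mem_degLE.1 γ.2) hβdeg
      have : monomial (γ : σ →₀ ℕ) (1 : K) * ((∏ j ∈ Aᶜ, Q a j) * monomial β (coeff β g)) =
          coeff β g • (monomial ((γ : σ →₀ ℕ) + β) (1 : K) * ∏ j ∈ Aᶜ, Q a j) := by
        rw [show monomial β (coeff β g) = coeff β g • monomial β (1 : K) by
          rw [smul_monomial, smul_eq_mul, mul_one], mul_smul_comm, mul_smul_comm]
        congr 1
        rw [mul_comm (∏ j ∈ Aᶜ, Q a j), ← mul_assoc, monomial_mul, mul_one]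
      rw [this]
      exact Submodule.smul_mem _ _ (Submodule.subset_span ⟨⟨a, ⟨A, hA⟩, ⟨_, hγβ⟩⟩, rfl⟩)
    exact key hmem
  haveI : Module.Finite K (Submodule.span K (Set.range w)) :=
    Module.Finite.span_of_finite K (Set.finite_range w)
  calc Module.finrank K (shifted Ls ℓ (∑ i, ∏ j, Q i j))
      ≤ Module.finrank K (Submodule.span K (Set.range w)) := Submodule.finrank_mono hle
    _ ≤ Fintype.card (Fin s × {A : Finset (Fin D) // A.card ≤ k} ×
          degLE σ (ℓ + k * (t - 1))) := finrank_range_le_card w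
    _ = s * numSubsetsLE D k * (degLE σ (ℓ + k * (t - 1))).card := by
        rw [Fintype.card_prod, Fintype.card_prod, Fintype.card_fin, Fintype.card_coe,
          Fintype.card_subtype, numSubsetsLE, mul_assoc]

end Count

/-! ## §4 The lower bound for permanent-like polynomials (GKKS 2014, §5)

### §4a Block families of increasing sequences and the canonical permutation -/

/-- Parameters of a block family: an `n × n` matrix, `k` blocks of `L` consecutive rows/columns
each (`k L ≤ n`), and a half-width `h` with `2h ≤ L`. [folklore] -/
structure Blocks where
  /-- matrix size -/
  n : ℕ
  /-- number of blocks = order of the derivatives -/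
  k : ℕ
  /-- block length -/
  L : ℕ
  /-- half-width: the unused column of a block lies in its first half, the unused row in its
  second half -/
  h : ℕ
  /-- `2h ≤ L` -/
  two_h_le : 2 * h ≤ L
  /-- `kL ≤ n` -/
  kL_le : k * L ≤ n

namespace Blocks

variable (P : Blocks)

/-- The index set `Θ = ([h]^k)²` of the block family. [folklore] -/
abbrev Theta : Type := (Fin P.k → Fin P.h) × (Fin P.k → Fin P.h)

/-- The unused COLUMN `a_j = jL + u_j` of block `j`. [folklore] -/
def a (θ : P.Theta) (j : Fin P.k) : ℕ := (j : ℕ) * P.L + (θ.1 j : ℕ)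

/-- The unused ROW `b_j = jL + h + v_j` of block `j`. [folklore] -/
def b (θ : P.Theta) (j : Fin P.k) : ℕ := (j : ℕ) * P.L + P.h + (θ.2 j : ℕ)

variable {P}

/-- `a_j < b_j`. [folklore] -/
theorem a_lt_b (θ : P.Theta) (j : Fin P.k) : P.a θ j < P.b θ j := by
  have := (θ.1 j).2
  simp only [a, b]; omega

/-- `jL ≤ a_j`. [folklore] -/
theorem le_a (θ : P.Theta) (j : Fin P.k) : (j : ℕ) * P.L ≤ P.a θ j := by
  simp only [a]; omega

/-- `b_j < (j+1)L`. [folklore] -/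
theorem b_lt (θ : P.Theta) (j : Fin P.k) : P.b θ j < ((j : ℕ) + 1) * P.L := by
  have := (θ.2 j).2
  have := P.two_h_le
  simp only [b]; rw [add_mul, one_mul]; omega

/-- `b_j < n`. [folklore] -/
theorem b_lt_n (θ : P.Theta) (j : Fin P.k) : P.b θ j < P.n := by
  have h1 := b_lt θ j
  have h2 : ((j : ℕ) + 1) * P.L ≤ P.k * P.L := Nat.mul_le_mul_right _ j.2
  have h3 := P.kL_le
  omega

/-- `a_j < n`. [folklore] -/
theorem a_lt_n (θ : P.Theta) (j : Fin P.k) : P.a θ j < P.n :=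
  (a_lt_b θ j).trans (b_lt_n θ j)

/-- Blocks are separated: for `j < j'`, `b_j < a_{j'}` (for any two members of the family).
[folklore] -/
theorem b_lt_a_of_lt (θ θ' : P.Theta) {j j' : Fin P.k} (hjj : j < j') : P.b θ j < P.a θ' j' := by
  have h1 := b_lt θ j
  have h2 := le_a θ' j'
  have h3 : ((j : ℕ) + 1) * P.L ≤ (j' : ℕ) * P.L :=
    Nat.mul_le_mul_right _ (by exact_mod_cast (Fin.lt_def.1 hjj : (j:ℕ) < j'))
  omega

/-- Trichotomy of blocks: equal index, or the intervals `[a, b]` are separated. [folklore] -/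
theorem trich (θ θ' : P.Theta) (j j' : Fin P.k) :
    j = j' ∨ P.b θ j < P.a θ' j' ∨ P.b θ' j' < P.a θ j := by
  rcases lt_trichotomy j j' with hlt | rfl | hgt
  · exact Or.inr (Or.inl (b_lt_a_of_lt θ θ' hlt))
  · exact Or.inl rfl
  · exact Or.inr (Or.inr (b_lt_a_of_lt θ' θ hgt))

/-- `a` is injective in the block index. [folklore] -/
theorem a_injective (θ : P.Theta) : Function.Injective (P.a θ) := by
  intro j j' hjj
  rcases trich θ θ j j' with h | h | h
  · exact h
  · have := a_lt_b θ j; omega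
  · have := a_lt_b θ j'; omega

/-- `b` is injective in the block index. [folklore] -/
theorem b_injective (θ : P.Theta) : Function.Injective (P.b θ) := by
  intro j j' hjj
  rcases trich θ θ j j' with h | h | h
  · exact h
  · have := a_lt_b θ j'; omega
  · have := a_lt_b θ j; omega

variable (P)

/-- `c ∈ ⋃_j (a_j, b_j]`. [folklore] -/
def inIoc (θ : P.Theta) (c : ℕ) : Prop := ∃ j, P.a θ j < c ∧ c ≤ P.b θ j

/-- `r ∈ ⋃_j [a_j, b_j)`. [folklore] -/
def inIco (θ : P.Theta) (r : ℕ) : Prop := ∃ j, P.a θ j ≤ r ∧ r < P.b θ j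

/-- `c ∈ ⋃_j [a_j, b_j]`. [folklore] -/
def inIcc (θ : P.Theta) (c : ℕ) : Prop := ∃ j, P.a θ j ≤ c ∧ c ≤ P.b θ j

/-- `c` is an unused column `a_j`. [folklore] -/
def isA (θ : P.Theta) (c : ℕ) : Prop := ∃ j, c = P.a θ j

/-- `r` is an unused row `b_j`. [folklore] -/
def isB (θ : P.Theta) (r : ℕ) : Prop := ∃ j, r = P.b θ j

/-- Decidability of `inIoc` (a finite disjunction). [folklore] -/
instance decidableInIoc (θ : P.Theta) (c : ℕ) : Decidable (P.inIoc θ c) := by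
  unfold inIoc; infer_instance

/-- Decidability of `inIco`. [folklore] -/
instance decidableInIco (θ : P.Theta) (c : ℕ) : Decidable (P.inIco θ c) := by
  unfold inIco; infer_instance

/-- Decidability of `inIcc`. [folklore] -/
instance decidableInIcc (θ : P.Theta) (c : ℕ) : Decidable (P.inIcc θ c) := by
  unfold inIcc; infer_instance

/-- Decidability of `isA`. [folklore] -/
instance decidableIsA (θ : P.Theta) (c : ℕ) : Decidable (P.isA θ c) := by
  unfold isA; infer_instance

/-- Decidability of `isB`. [folklore] -/
instance decidableIsB (θ : P.Theta) (c : ℕ) : Decidable (P.isB θ c) := by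
  unfold isB; infer_instance

/-- The canonical permutation `σ₀` (columns ↦ rows) of the member `θ`, on `ℕ`:
`c ↦ c - 1` on `⋃ (a_j, b_j]` (super-diagonal cells), `a_j ↦ b_j`, identity elsewhere
(diagonal cells). [folklore] -/
def sigma0Fun (θ : P.Theta) (c : ℕ) : ℕ :=
  if P.inIoc θ c then c - 1
  else if hc : P.isA θ c then P.b θ (Classical.choose hc)
  else c

/-- The inverse `ρ₀` of `σ₀` (rows ↦ columns): `r ↦ r + 1` on `⋃ [a_j, b_j)`, `b_j ↦ a_j`,
identity elsewhere. [folklore] -/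
def rho0Fun (θ : P.Theta) (r : ℕ) : ℕ :=
  if P.inIco θ r then r + 1
  else if hr : P.isB θ r then P.a θ (Classical.choose hr)
  else r

variable {P}

/-- The block index recovered from an unused column. [folklore] -/
theorem choose_isA {θ : P.Theta} {c : ℕ} (hc : P.isA θ c) {j : Fin P.k} (hj : c = P.a θ j) :
    Classical.choose hc = j :=
  a_injective θ ((Classical.choose_spec hc).symm.trans hj)

/-- The block index recovered from an unused row. [folklore] -/
theorem choose_isB {θ : P.Theta} {r : ℕ} (hr : P.isB θ r) {j : Fin P.k} (hj : r = P.b θ j) :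
    Classical.choose hr = j :=
  b_injective θ ((Classical.choose_spec hr).symm.trans hj)

/-- `a_j ∉ ⋃ (a_{j'}, b_{j'}]`. [folklore] -/
theorem not_inIoc_a (θ : P.Theta) (j : Fin P.k) : ¬ P.inIoc θ (P.a θ j) := by
  rintro ⟨j', h1, h2⟩
  rcases trich θ θ j j' with h | h | h
  · subst h; omega
  · have := a_lt_b θ j; omega
  · omega

/-- `b_j ∉ ⋃ [a_{j'}, b_{j'})`. [folklore] -/
theorem not_inIco_b (θ : P.Theta) (j : Fin P.k) : ¬ P.inIco θ (P.b θ j) := by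
  rintro ⟨j', h1, h2⟩
  rcases trich θ θ j j' with h | h | h
  · subst h; omega
  · omega
  · have := a_lt_b θ j; omega

/-- `σ₀ a_j = b_j`. [folklore] -/
theorem sigma0Fun_a (θ : P.Theta) (j : Fin P.k) : P.sigma0Fun θ (P.a θ j) = P.b θ j := by
  have hA : P.isA θ (P.a θ j) := ⟨j, rfl⟩
  simp only [sigma0Fun, not_inIoc_a, if_false, hA, dif_pos]
  rw [choose_isA hA rfl]

/-- `σ₀ c = c - 1` on `⋃ (a_j, b_j]`. [folklore] -/
theorem sigma0Fun_of_inIoc {θ : P.Theta} {c : ℕ} (hc : P.inIoc θ c) : P.sigma0Fun θ c = c - 1 := by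
  simp [sigma0Fun, hc]

/-- `σ₀ c = c` off `⋃ (a_j, b_j] ∪ {a_j}`. [folklore] -/
theorem sigma0Fun_of_not {θ : P.Theta} {c : ℕ} (h1 : ¬ P.inIoc θ c) (h2 : ¬ P.isA θ c) :
    P.sigma0Fun θ c = c := by
  simp [sigma0Fun, h1, h2]

/-- `ρ₀ b_j = a_j`. [folklore] -/
theorem rho0Fun_b (θ : P.Theta) (j : Fin P.k) : P.rho0Fun θ (P.b θ j) = P.a θ j := by
  have hB : P.isB θ (P.b θ j) := ⟨j, rfl⟩
  simp only [rho0Fun, not_inIco_b, if_false, hB, dif_pos]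
  rw [choose_isB hB rfl]

/-- `ρ₀ r = r + 1` on `⋃ [a_j, b_j)`. [folklore] -/
theorem rho0Fun_of_inIco {θ : P.Theta} {r : ℕ} (hr : P.inIco θ r) : P.rho0Fun θ r = r + 1 := by
  simp [rho0Fun, hr]

/-- `ρ₀ r = r` off `⋃ [a_j, b_j) ∪ {b_j}`. [folklore] -/
theorem rho0Fun_of_not {θ : P.Theta} {r : ℕ} (h1 : ¬ P.inIco θ r) (h2 : ¬ P.isB θ r) :
    P.rho0Fun θ r = r := by
  simp [rho0Fun, h1, h2]

/-- `ρ₀ ∘ σ₀ = id`. [folklore] -/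
theorem rho0Fun_sigma0Fun (θ : P.Theta) (c : ℕ) : P.rho0Fun θ (P.sigma0Fun θ c) = c := by
  by_cases h1 : P.inIoc θ c
  · obtain ⟨j, hj1, hj2⟩ := h1
    rw [sigma0Fun_of_inIoc ⟨j, hj1, hj2⟩, rho0Fun_of_inIco ⟨j, by omega, by omega⟩]
    omega
  by_cases h2 : P.isA θ c
  · obtain ⟨j, rfl⟩ := h2
    rw [sigma0Fun_a, rho0Fun_b]
  rw [sigma0Fun_of_not h1 h2]
  apply rho0Fun_of_not
  · rintro ⟨j, hj1, hj2⟩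
    rcases Nat.eq_or_lt_of_le hj1 with h | h
    · exact h2 ⟨j, h.symm⟩
    · exact h1 ⟨j, h, hj2.le⟩
  · rintro ⟨j, rfl⟩
    exact h1 ⟨j, a_lt_b θ j, le_rfl⟩

/-- `σ₀ ∘ ρ₀ = id`. [folklore] -/
theorem sigma0Fun_rho0Fun (θ : P.Theta) (r : ℕ) : P.sigma0Fun θ (P.rho0Fun θ r) = r := by
  by_cases h1 : P.inIco θ r
  · obtain ⟨j, hj1, hj2⟩ := h1
    rw [rho0Fun_of_inIco ⟨j, hj1, hj2⟩, sigma0Fun_of_inIoc ⟨j, by omega, by omega⟩]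
    omega
  by_cases h2 : P.isB θ r
  · obtain ⟨j, rfl⟩ := h2
    rw [rho0Fun_b, sigma0Fun_a]
  rw [rho0Fun_of_not h1 h2]
  apply sigma0Fun_of_not
  · rintro ⟨j, hj1, hj2⟩
    rcases Nat.eq_or_lt_of_le hj2 with h | h
    · exact h2 ⟨j, h⟩
    · exact h1 ⟨j, hj1.le, h⟩
  · rintro ⟨j, rfl⟩
    exact h1 ⟨j, le_rfl, a_lt_b θ j⟩

/-- `σ₀` preserves `[0, n)`. [folklore] -/
theorem sigma0Fun_lt (θ : P.Theta) {c : ℕ} (hc : c < P.n) : P.sigma0Fun θ c < P.n := by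
  by_cases h1 : P.inIoc θ c
  · rw [sigma0Fun_of_inIoc h1]; omega
  by_cases h2 : P.isA θ c
  · obtain ⟨j, rfl⟩ := h2
    rw [sigma0Fun_a]; exact b_lt_n θ j
  rw [sigma0Fun_of_not h1 h2]; exact hc

/-- `ρ₀` preserves `[0, n)`. [folklore] -/
theorem rho0Fun_lt (θ : P.Theta) {r : ℕ} (hr : r < P.n) : P.rho0Fun θ r < P.n := by
  by_cases h1 : P.inIco θ r
  · obtain ⟨j, hj1, hj2⟩ := h1
    rw [rho0Fun_of_inIco ⟨j, hj1, hj2⟩]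
    have := b_lt_n θ j; omega
  by_cases h2 : P.isB θ r
  · obtain ⟨j, rfl⟩ := h2
    rw [rho0Fun_b]; exact a_lt_n θ j
  rw [rho0Fun_of_not h1 h2]; exact hr

variable (P)

/-- The canonical permutation `σ₀(θ)` of `Fin n` (columns ↦ rows) whose graph off the unused
columns is the `(n-k)`-increasing sequence `Q_θ` and which sends `a_j ↦ b_j`. [folklore] -/
def sigma0 (θ : P.Theta) : Equiv.Perm (Fin P.n) where
  toFun c := ⟨P.sigma0Fun θ c, sigma0Fun_lt θ c.2⟩
  invFun r := ⟨P.rho0Fun θ r, rho0Fun_lt θ r.2⟩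
  left_inv c := Fin.ext (rho0Fun_sigma0Fun θ c)
  right_inv r := Fin.ext (sigma0Fun_rho0Fun θ r)

variable {P}

/-- `σ₀ c` as a natural number. [folklore] -/
@[simp] theorem sigma0_apply_val (θ : P.Theta) (c : Fin P.n) :
    ((P.sigma0 θ c : Fin P.n) : ℕ) = P.sigma0Fun θ c := rfl

/-- `σ₀⁻¹ r` as a natural number. [folklore] -/
@[simp] theorem sigma0_symm_apply_val (θ : P.Theta) (r : Fin P.n) :
    (((P.sigma0 θ).symm r : Fin P.n) : ℕ) = P.rho0Fun θ r := rfl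

/-- Off the unused columns, `(σ₀ c, c)` is a diagonal cell outside `⋃ [a_j, b_j]` or a
super-diagonal cell with column in `⋃ (a_j, b_j]`. [folklore] -/
theorem sigma0Fun_dichotomy (θ : P.Theta) {c : ℕ} (hc : ¬ P.isA θ c) :
    (P.sigma0Fun θ c = c ∧ ¬ P.inIcc θ c) ∨ (P.sigma0Fun θ c + 1 = c ∧ P.inIoc θ c) := by
  by_cases h1 : P.inIoc θ c
  · right
    obtain ⟨j, hj1, hj2⟩ := h1
    rw [sigma0Fun_of_inIoc ⟨j, hj1, hj2⟩]
    exact ⟨by omega, j, hj1, hj2⟩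
  · left
    refine ⟨sigma0Fun_of_not h1 hc, ?_⟩
    rintro ⟨j, hj1, hj2⟩
    rcases Nat.eq_or_lt_of_le hj1 with h | h
    · exact hc ⟨j, h.symm⟩
    · exact h1 ⟨j, h, hj2⟩

/-- Description of `ρ₀ r`: identity off `⋃ [a_j, b_j]`, `r ↦ r + 1` on `⋃ [a_j, b_j)`,
`b_j ↦ a_j`. [folklore] -/
theorem rho0Fun_trichotomy (θ : P.Theta) (r : ℕ) :
    (P.rho0Fun θ r = r ∧ ¬ P.inIcc θ r) ∨ (P.rho0Fun θ r = r + 1 ∧ P.inIco θ r) ∨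
      (∃ j, r = P.b θ j ∧ P.rho0Fun θ r = P.a θ j) := by
  by_cases h1 : P.inIco θ r
  · exact Or.inr (Or.inl ⟨rho0Fun_of_inIco h1, h1⟩)
  by_cases h2 : P.isB θ r
  · obtain ⟨j, rfl⟩ := h2
    exact Or.inr (Or.inr ⟨j, rfl, rho0Fun_b θ j⟩)
  refine Or.inl ⟨rho0Fun_of_not h1 h2, ?_⟩
  rintro ⟨j, hj1, hj2⟩
  rcases Nat.eq_or_lt_of_le hj2 with h | h
  · exact h2 ⟨j, h⟩
  · exact h1 ⟨j, hj1, h⟩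

/-- **Uniqueness of the perfect matching** (the heart of GKKS 2014, Cor. 13 / Lemma 14 in our
rendering): a permutation `σ` of the columns with `σ a_j = b_j` whose remaining cells
`(σ c, c)` all lie on the two diagonals `D₂` is the canonical permutation `σ₀`. (The cells of
`D₂` form a path `c₀ – r₀ – c₁ – r₁ – ⋯`, and a set of vertices of a path has at most one perfect
matching.) [folklore] -/
theorem eq_sigma0 (θ : P.Theta) (σ : Equiv.Perm (Fin P.n))
    (hgood : ∀ j, ((σ ⟨P.a θ j, a_lt_n θ j⟩ : Fin P.n) : ℕ) = P.b θ j)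
    (hdiag : ∀ c : Fin P.n, ¬ P.isA θ c → (((σ c : Fin P.n) : ℕ) = c ∨ ((σ c : Fin P.n) : ℕ) + 1 = c)) :
    σ = P.sigma0 θ := by
  suffices H : ∀ m : ℕ, ∀ r : Fin P.n, (r : ℕ) = m →
      ((σ.symm r : Fin P.n) : ℕ) = P.rho0Fun θ r by
    have hs : σ.symm = (P.sigma0 θ).symm := Equiv.ext fun r => Fin.ext (H r r rfl)
    simpa using congrArg Equiv.symm hs
  intro m
  induction m using Nat.strong_induction_on with
  | _ m ih =>
  intro r hr
  have hσc : σ (σ.symm r) = r := Equiv.apply_symm_apply σ r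
  by_cases hA : P.isA θ (σ.symm r)
  · obtain ⟨j, hj⟩ := hA
    have hcj : σ.symm r = ⟨P.a θ j, a_lt_n θ j⟩ := Fin.ext hj
    have hrb : (r : ℕ) = P.b θ j := by rw [← hgood j, ← hcj, hσc]
    rw [hj, show P.rho0Fun θ r = P.rho0Fun θ (P.b θ j) by rw [hrb], rho0Fun_b]
  have hd := hdiag (σ.symm r) hA
  rw [hσc] at hd
  rcases rho0Fun_trichotomy θ r with ⟨hρ, hnot⟩ | ⟨hρ, hin⟩ | ⟨j, hrb, hρ⟩
  · -- diagonal row: `ρ₀ r = r`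
    rw [hρ]
    rcases hd with hd | hd
    · exact hd.symm
    · exfalso
      have hAr : ¬ P.isA θ r := by
        rintro ⟨j, hj⟩
        have := a_lt_b θ j
        exact hnot ⟨j, by omega, by omega⟩
      rcases hdiag r hAr with h1 | h1
      · have heq : r = σ.symm r := σ.injective (Fin.ext (by rw [h1, hσc]))
        have := congrArg Fin.val heq
        omega
      · have hlt : ((σ r : Fin P.n) : ℕ) < m := by omega
        have ih' := ih _ hlt (σ r) rfl
        rw [Equiv.symm_apply_apply] at ih'
        rcases rho0Fun_trichotomy θ (σ r) with ⟨hρ', -⟩ | ⟨hρ', hin'⟩ | ⟨j, hrb', hρ'⟩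
        · omega
        · obtain ⟨j, hj1, hj2⟩ := hin'
          exact hnot ⟨j, by omega, by omega⟩
        · have := a_lt_b θ j
          omega
  · -- super-diagonal row: `ρ₀ r = r + 1`
    rw [hρ]
    rcases hd with hd | hd
    · exfalso
      obtain ⟨j, hj1, hj2⟩ := hin
      have hne : (r : ℕ) ≠ P.a θ j := fun h => hA ⟨j, by omega⟩
      have hr1 : 1 ≤ (r : ℕ) := by omega
      have hr' : (r : ℕ) - 1 < P.n := by omega
      have hlt : (r : ℕ) - 1 < m := by omega
      have ih' := ih _ hlt ⟨(r : ℕ) - 1, hr'⟩ rfl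
      have hin' : P.inIco θ ((r : ℕ) - 1) := ⟨j, by omega, by omega⟩
      rw [rho0Fun_of_inIco hin'] at ih'
      have h2 : σ.symm ⟨(r : ℕ) - 1, hr'⟩ = σ.symm r := Fin.ext (by rw [ih']; omega)
      have h3 := congrArg Fin.val (σ.symm.injective h2)
      simp only at h3
      omega
    · exact hd.symm
  · -- unused row `b_j`: then the column is `a_j`, excluded
    exfalso
    apply hA
    refine ⟨j, ?_⟩
    have : σ (σ.symm r) = σ ⟨P.a θ j, a_lt_n θ j⟩ := Fin.ext (by rw [hσc, hgood j, hrb])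
    exact congrArg Fin.val (σ.injective this)

/-! ### §4b Cells, weights and the monomials of minors -/

variable (P)

/-- The unused column `a_j` as an element of `Fin n`. [folklore] -/
def colA (θ : P.Theta) (j : Fin P.k) : Fin P.n := ⟨P.a θ j, a_lt_n θ j⟩

/-- The unused row `b_j` as an element of `Fin n`. [folklore] -/
def rowB (θ : P.Theta) (j : Fin P.k) : Fin P.n := ⟨P.b θ j, b_lt_n θ j⟩

/-- The set of unused columns `{a_j}`. [folklore] -/
def Acols (θ : P.Theta) : Finset (Fin P.n) := Finset.univ.image (P.colA θ)

/-- `σ` is GOOD for `θ` if `σ a_j = b_j` for all `j` (exactly the permutation monomials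
`∏ X_{σ i, i}` surviving the derivative `∂_θ = ∏_j ∂/∂X_{b_j, a_j}`). [folklore] -/
def good (θ : P.Theta) (σ : Equiv.Perm (Fin P.n)) : Prop := ∀ j, σ (P.colA θ j) = P.rowB θ j

/-- Decidability of `good` (finitely many equalities in `Fin n`). [folklore] -/
instance decidableGood (θ : P.Theta) (σ : Equiv.Perm (Fin P.n)) : Decidable (P.good θ σ) := by
  unfold good; infer_instance

/-- The weight of a cell: `1` on the two diagonals `D₂ = {(i,i)} ∪ {(i,i+1)}`, else `0`
(GKKS 2014, §5.1). [cite: GuptaKamathKayalSaptharishi2014, §5.1] -/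
def dw (v : Fin P.n × Fin P.n) : ℕ := if (v.2 : ℕ) = v.1 ∨ (v.2 : ℕ) = v.1 + 1 then 1 else 0

/-- The `D₂`-weight of an exponent vector: number of variables on the two diagonals, with
multiplicity. [folklore] -/
def wt : (Fin P.n × Fin P.n →₀ ℕ) →+ ℕ := Finsupp.weight P.dw

/-- The exponent vector `∑_{i ∈ S} e_{(σ i, i)}` of the partial permutation monomial
`∏_{i∈S} X_{σ i, i}`. [folklore] -/
def mono (S : Finset (Fin P.n)) (σ : Equiv.Perm (Fin P.n)) : (Fin P.n × Fin P.n) →₀ ℕ :=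
  ∑ i ∈ S, Finsupp.single (σ i, i) 1

variable {P}

/-- `colA` is injective. [folklore] -/
theorem colA_injective (θ : P.Theta) : Function.Injective (P.colA θ) := fun _ _ h =>
  a_injective θ (congrArg Fin.val h :)

/-- Membership in `Acols`. [folklore] -/
theorem mem_Acols {θ : P.Theta} {c : Fin P.n} : c ∈ P.Acols θ ↔ P.isA θ c := by
  simp only [Acols, Finset.mem_image, Finset.mem_univ, true_and, isA]
  constructor
  · rintro ⟨j, hj⟩; exact ⟨j, by rw [← hj]; rfl⟩
  · rintro ⟨j, hj⟩; exact ⟨j, Fin.ext hj.symm⟩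

/-- `|Acols| = k`. [folklore] -/
theorem card_Acols (θ : P.Theta) : (P.Acols θ).card = P.k := by
  rw [Acols, Finset.card_image_of_injective _ (colA_injective θ), Finset.card_univ,
    Fintype.card_fin]

/-- `|Acolsᶜ| = n - k`. [folklore] -/
theorem card_Acols_compl (θ : P.Theta) : (P.Acols θ)ᶜ.card = P.n - P.k := by
  rw [Finset.card_compl, card_Acols, Fintype.card_fin]

/-- `σ₀` is good. [folklore] -/
theorem good_sigma0 (θ : P.Theta) : P.good θ (P.sigma0 θ) := fun j =>
  Fin.ext (sigma0Fun_a θ j)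

/-- `dw v = 1` iff `v` is a diagonal or super-diagonal cell. [folklore] -/
theorem dw_eq_one_iff (v : Fin P.n × Fin P.n) :
    P.dw v = 1 ↔ ((v.2 : ℕ) = v.1 ∨ (v.2 : ℕ) = v.1 + 1) := by
  unfold dw; split_ifs with h <;> simp [h]

/-- `dw v ≤ 1`. [folklore] -/
theorem dw_le_one (v : Fin P.n × Fin P.n) : P.dw v ≤ 1 := by
  unfold dw; split_ifs <;> simp

/-- `wt (e_v) = dw v`. [folklore] -/
@[simp] theorem wt_single (v : Fin P.n × Fin P.n) (r : ℕ) : P.wt (Finsupp.single v r) = r * P.dw v := by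
  simp [wt, Finsupp.weight_single]

/-- The value of `mono S σ` at a cell. [folklore] -/
theorem mono_apply (S : Finset (Fin P.n)) (σ : Equiv.Perm (Fin P.n)) (r c : Fin P.n) :
    P.mono S σ (r, c) = if c ∈ S ∧ σ c = r then 1 else 0 := by
  classical
  simp only [mono, Finsupp.coe_finsetSum, Finset.sum_apply, Finsupp.single_apply, Prod.mk.injEq]
  by_cases hc : c ∈ S
  · rw [Finset.sum_eq_single c]
    · by_cases h : σ c = r <;> simp [h, hc]
    · intro i _ hi; simp [hi]
    · intro h; exact absurd hc h
  · rw [Finset.sum_eq_zero]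
    · simp [hc]
    · intro i hi
      have : i ≠ c := fun h => hc (h ▸ hi)
      simp [this]

/-- `wt (mono S σ) = ∑_{i∈S} dw (σ i, i)`. [folklore] -/
theorem wt_mono (S : Finset (Fin P.n)) (σ : Equiv.Perm (Fin P.n)) :
    P.wt (P.mono S σ) = ∑ i ∈ S, P.dw (σ i, i) := by
  simp [mono, map_sum]

/-- `wt (mono S σ) ≤ |S|`. [folklore] -/
theorem wt_mono_le (S : Finset (Fin P.n)) (σ : Equiv.Perm (Fin P.n)) :
    P.wt (P.mono S σ) ≤ S.card := by
  rw [wt_mono, Finset.card_eq_sum_ones]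
  exact Finset.sum_le_sum fun i _ => dw_le_one _

/-- `wt (mono S σ) = |S|` iff every cell `(σ i, i)`, `i ∈ S`, is on the two diagonals.
[folklore] -/
theorem wt_mono_eq_card_iff (S : Finset (Fin P.n)) (σ : Equiv.Perm (Fin P.n)) :
    P.wt (P.mono S σ) = S.card ↔ ∀ i ∈ S, P.dw (σ i, i) = 1 := by
  rw [wt_mono, Finset.card_eq_sum_ones]
  exact Finset.sum_eq_sum_iff_of_le fun i _ => dw_le_one _

/-- The remaining-cells monomial of the canonical permutation has full weight `n - k`.
[folklore] -/
theorem wt_mono_sigma0 (θ : P.Theta) : P.wt (P.mono (P.Acols θ)ᶜ (P.sigma0 θ)) = P.n - P.k := by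
  rw [← card_Acols_compl θ, wt_mono_eq_card_iff]
  intro c hc
  rw [Finset.mem_compl, mem_Acols] at hc
  rw [dw_eq_one_iff]
  rcases sigma0Fun_dichotomy θ hc with ⟨h, -⟩ | ⟨h, -⟩
  · left; simp [h]
  · right; simp [h]

/-- **Unique maximal weight**: a good permutation other than `σ₀` has remaining-cells monomial
of weight `< n - k`. [folklore] -/
theorem wt_mono_lt (θ : P.Theta) {σ : Equiv.Perm (Fin P.n)} (hg : P.good θ σ)
    (hne : σ ≠ P.sigma0 θ) : P.wt (P.mono (P.Acols θ)ᶜ σ) < P.n - P.k := by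
  refine lt_of_le_of_ne (card_Acols_compl θ ▸ wt_mono_le _ _) fun heq => hne ?_
  rw [← card_Acols_compl θ, wt_mono_eq_card_iff] at heq
  refine eq_sigma0 θ σ (fun j => ?_) fun c hc => ?_
  · have := hg j
    simp only [colA, rowB] at this
    rw [this]
  · have h1 := heq c (by rw [Finset.mem_compl, mem_Acols]; exact hc)
    rw [dw_eq_one_iff] at h1
    rcases h1 with h1 | h1
    · left; exact h1.symm
    · right; exact h1.symm

/-! ### §4c The derivative of a permanent-like polynomial along a block member -/

variable (P)

/-- The derivative variables of the member `θ`: `X_{b_j, a_j}`, `j < k`. [folklore] -/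
def dvars (θ : P.Theta) : List (Fin P.n × Fin P.n) := List.ofFn fun j => (P.rowB θ j, P.colA θ j)

/-- A PERMANENT-LIKE polynomial `f_c = ∑_σ c_σ ∏_i X_{σ i, i}` (`per_n`: `c = 1`; `det_n`:
`c = sign`). [folklore] -/
def fpoly {K : Type*} [CommRing K] (c : Equiv.Perm (Fin P.n) → K) :
    MvPolynomial (Fin P.n × Fin P.n) K :=
  ∑ σ, monomial (P.mono Finset.univ σ) (c σ)

/-- The PIVOT exponent of the shifted minor `x^γ ∂_θ f`: `γ + 1_{Q_θ}`. [folklore] -/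
def piv (θ : P.Theta) (γ : (Fin P.n × Fin P.n) →₀ ℕ) : (Fin P.n × Fin P.n) →₀ ℕ :=
  γ + P.mono (P.Acols θ)ᶜ (P.sigma0 θ)

variable {P}

/-- `|L_θ| = k`. [folklore] -/
theorem length_dvars (θ : P.Theta) : (P.dvars θ).length = P.k := by simp [dvars]

/-- The derivative variables are distinct. [folklore] -/
theorem nodup_dvars (θ : P.Theta) : (P.dvars θ).Nodup :=
  List.nodup_ofFn_ofInjective fun _ _ h => colA_injective θ (congrArg Prod.snd h)

/-- For a good `σ`, the derivative variables are the cells `(σ a_j, a_j)`. [folklore] -/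
theorem mono_Acols_of_good {θ : P.Theta} {σ : Equiv.Perm (Fin P.n)} (hg : P.good θ σ) :
    P.mono (P.Acols θ) σ = listInd (P.dvars θ) := by
  rw [dvars, listInd_ofFn, mono, Acols, Finset.sum_image fun j _ j' _ h => colA_injective θ h]
  refine Finset.sum_congr rfl fun j _ => ?_
  rw [hg j]

/-- `1_{all cells of σ} = 1_{cells over Acols} + 1_{remaining cells}`. [folklore] -/
theorem mono_univ_eq (θ : P.Theta) (σ : Equiv.Perm (Fin P.n)) :
    P.mono Finset.univ σ = P.mono (P.Acols θ) σ + P.mono (P.Acols θ)ᶜ σ :=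
  (Finset.sum_add_sum_compl (P.Acols θ) _).symm

/-- **The derivative of a permanent-like polynomial is a sum of (weighted) minors**:
`∂_θ f_c = ∑_{σ good} c_σ x^{1_{remaining cells of σ}}` (GKKS 2014, §5: "any partial derivative
of `Perm_n` is just the corresponding permanental minor"). [cite: GuptaKamathKayalSaptharishi2014, §5] -/
theorem iterPderiv_fpoly {K : Type*} [CommRing K] (θ : P.Theta) (c : Equiv.Perm (Fin P.n) → K) :
    iterPderiv (P.dvars θ) (P.fpoly c) =
      ∑ σ ∈ Finset.univ.filter (P.good θ), monomial (P.mono (P.Acols θ)ᶜ σ) (c σ) := by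
  classical
  rw [fpoly, map_sum, Finset.sum_filter]
  refine Finset.sum_congr rfl fun σ _ => ?_
  rw [iterPderiv_monomial _ (nodup_dvars θ)]
  have hprod : ((P.dvars θ).map fun v => ((P.mono Finset.univ σ v : ℕ) : K)).prod =
      if P.good θ σ then 1 else 0 := by
    rw [dvars, List.map_ofFn, List.prod_ofFn]
    have : ∀ j, ((fun v : Fin P.n × Fin P.n => ((P.mono Finset.univ σ v : ℕ) : K)) ∘
        fun j => (P.rowB θ j, P.colA θ j)) j = if σ (P.colA θ j) = P.rowB θ j then 1 else 0 := by
      intro j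
      simp only [Function.comp_apply, mono_apply, Finset.mem_univ, true_and]
      split_ifs <;> simp
    simp_rw [this]
    rw [Fintype.prod_boole]
    by_cases hg : P.good θ σ
    · rw [if_pos hg, if_pos fun i => hg i]
    · rw [if_neg hg, if_neg (show ¬ ∀ i : Fin P.k, σ (P.colA θ i) = P.rowB θ i from hg)]
  rw [hprod]
  by_cases hg : P.good θ σ
  · rw [if_pos hg, if_pos hg, mul_one, mono_univ_eq θ σ, mono_Acols_of_good hg, add_comm,
      add_tsub_cancel_right]
  · rw [if_neg hg, if_neg hg, mul_zero, map_zero]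

/-- Coefficients of a shifted minor: `coeff_Φ (x^γ ∂_θ f_c) = ∑_{σ good, γ + 1_σ' = Φ} c_σ`.
[folklore] -/
theorem coeff_shift {K : Type*} [CommRing K] (θ : P.Theta) (c : Equiv.Perm (Fin P.n) → K)
    (γ Φ : (Fin P.n × Fin P.n) →₀ ℕ) :
    coeff Φ (monomial γ 1 * iterPderiv (P.dvars θ) (P.fpoly c)) =
      ∑ σ ∈ Finset.univ.filter (P.good θ),
        if γ + P.mono (P.Acols θ)ᶜ σ = Φ then c σ else 0 := by
  classical
  rw [iterPderiv_fpoly, Finset.mul_sum, coeff_sum]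
  refine Finset.sum_congr rfl fun σ _ => ?_
  rw [monomial_mul, one_mul, coeff_monomial]

/-- **Own pivot**: the coefficient of the pivot `γ + 1_{Q_θ}` in `x^γ ∂_θ f_c` is `c_{σ₀}`
(only `σ₀` reaches the maximal weight). [folklore] -/
theorem coeff_piv_self {K : Type*} [CommRing K] (θ : P.Theta) (c : Equiv.Perm (Fin P.n) → K)
    (γ : (Fin P.n × Fin P.n) →₀ ℕ) :
    coeff (P.piv θ γ) (monomial γ 1 * iterPderiv (P.dvars θ) (P.fpoly c)) = c (P.sigma0 θ) := by
  classical
  rw [coeff_shift, Finset.sum_eq_single (P.sigma0 θ)]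
  · exact if_pos rfl
  · intro σ hσ hne
    rw [Finset.mem_filter] at hσ
    rw [if_neg]
    intro h
    have h1 := congrArg P.wt h
    rw [piv, map_add, map_add, wt_mono_sigma0] at h1
    have h2 := wt_mono_lt θ hσ.2 hne
    omega
  · intro h
    exact absurd (Finset.mem_filter.2 ⟨Finset.mem_univ _, good_sigma0 θ⟩) h

/-- **Foreign pivot**: the coefficient of a DIFFERENT pivot of no smaller weight vanishes.
[folklore] -/
theorem coeff_piv_other {K : Type*} [CommRing K] {θ θ' : P.Theta}
    {γ γ' : (Fin P.n × Fin P.n) →₀ ℕ} (c : Equiv.Perm (Fin P.n) → K)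
    (hne : P.piv θ' γ' ≠ P.piv θ γ) (hwt : P.wt (P.piv θ' γ') ≤ P.wt (P.piv θ γ)) :
    coeff (P.piv θ γ) (monomial γ' 1 * iterPderiv (P.dvars θ') (P.fpoly c)) = 0 := by
  classical
  rw [coeff_shift]
  refine Finset.sum_eq_zero fun σ hσ => ?_
  rw [Finset.mem_filter] at hσ
  rw [if_neg]
  intro h
  by_cases hσ0 : σ = P.sigma0 θ'
  · subst hσ0; exact hne h
  · have h1 := wt_mono_lt θ' hσ.2 hσ0
    have h2 := congrArg P.wt h
    rw [map_add] at h2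
    rw [piv, map_add, wt_mono_sigma0] at hwt
    omega

/-! ### §4d The increasing sequence `Q_θ`, admissible shifts, and decoding -/

variable (P)

/-- The `(n-k)`-increasing sequence `Q_θ` of the member `θ`, as a predicate on cells `(r, c)`
with natural coordinates: the diagonal cells `(i,i)`, `i ∉ ⋃ [a_j, b_j]`, and the super-diagonal
cells `(i, i+1)`, `i ∈ ⋃ [a_j, b_j)`. [folklore] -/
def InQ (θ : P.Theta) (r c : ℕ) : Prop :=
  r < P.n ∧ c < P.n ∧ ((r = c ∧ ¬ P.inIcc θ c) ∨ (c = r + 1 ∧ P.inIco θ r))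

/-- Decidability of `InQ`. [folklore] -/
instance decidableInQ (θ : P.Theta) (r c : ℕ) : Decidable (P.InQ θ r c) := by
  unfold InQ; infer_instance

/-- The ADMISSIBLE shift variables of `θ`: all cells except `(a_j, a_j)` and `(b_j, b_j + 1)`
(every other cell of the two diagonals is in `Q_θ` or is the "companion" of a cell of `Q_θ`,
GKKS 2014, proof of Lemma 14). [cite: GuptaKamathKayalSaptharishi2014, Lemma 14] -/
def V (θ : P.Theta) : Finset (Fin P.n × Fin P.n) :=
  Finset.univ.filter fun v => (¬ ∃ j, (v.1 : ℕ) = P.a θ j ∧ (v.2 : ℕ) = P.a θ j) ∧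
    ¬ ∃ j, (v.1 : ℕ) = P.b θ j ∧ (v.2 : ℕ) = P.b θ j + 1

/-- `Q_θ` on POSITIONS `p` of the path of the two diagonals: `p = 2i ↦ (i,i)`,
`p = 2i+1 ↦ (i,i+1)`. [folklore] -/
def PQ (θ : P.Theta) (p : ℕ) : Prop := P.InQ θ (p / 2) ((p + 1) / 2)

/-- An exponent vector read at natural coordinates (zero off the matrix). [folklore] -/
def ext (Φ : (Fin P.n × Fin P.n) →₀ ℕ) (r c : ℕ) : ℕ :=
  if h : r < P.n ∧ c < P.n then Φ (⟨r, h.1⟩, ⟨c, h.2⟩) else 0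

/-- The positions of the two-diagonal path occupied by the exponent vector `Φ`. [folklore] -/
def U (Φ : (Fin P.n × Fin P.n) →₀ ℕ) (p : ℕ) : Prop := P.ext Φ (p / 2) ((p + 1) / 2) ≠ 0

variable {P}

/-- `Q_θ` is the graph of `σ₀` off the unused columns. [folklore] -/
theorem inQ_iff_sigma0 (θ : P.Theta) (r c : ℕ) :
    ((r = c ∧ ¬ P.inIcc θ c) ∨ (c = r + 1 ∧ P.inIco θ r)) ↔
      (¬ P.isA θ c ∧ P.sigma0Fun θ c = r) := by
  constructor
  · rintro (⟨rfl, hn⟩ | ⟨rfl, j, hj1, hj2⟩)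
    · have hA : ¬ P.isA θ r := by
        rintro ⟨j, hj⟩
        have := a_lt_b θ j
        exact hn ⟨j, by omega, by omega⟩
      exact ⟨hA, sigma0Fun_of_not (fun ⟨j, h1, h2⟩ => hn ⟨j, h1.le, h2⟩) hA⟩
    · refine ⟨?_, ?_⟩
      · rintro ⟨j', hj'⟩
        have := a_lt_b θ j'
        rcases trich θ θ j j' with h | h | h
        · subst h; omega
        · omega
        · omega
      · rw [sigma0Fun_of_inIoc ⟨j, by omega, by omega⟩]
        omega
  · rintro ⟨hA, hσ⟩
    rcases sigma0Fun_dichotomy θ hA with ⟨h1, h2⟩ | ⟨h1, j, hj1, hj2⟩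
    · exact Or.inl ⟨by omega, h2⟩
    · exact Or.inr ⟨by omega, j, by omega, by omega⟩

/-- The remaining-cells monomial of `σ₀` is the indicator of `Q_θ`. [folklore] -/
theorem mono_sigma0_apply (θ : P.Theta) (r c : Fin P.n) :
    P.mono (P.Acols θ)ᶜ (P.sigma0 θ) (r, c) = if P.InQ θ r c then 1 else 0 := by
  have hiff : (c ∈ (P.Acols θ)ᶜ ∧ P.sigma0 θ c = r) ↔ P.InQ θ r c := by
    rw [Finset.mem_compl, mem_Acols, Fin.ext_iff, sigma0_apply_val, ← inQ_iff_sigma0, InQ]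
    simp
  rw [mono_apply]
  by_cases hq : P.InQ θ r c
  · rw [if_pos hq, if_pos (hiff.2 hq)]
  · rw [if_neg hq, if_neg fun h => hq (hiff.1 h)]

/-- **At most `2k` inadmissible variables**: `|V_θ| ≥ n² - 2k`. [folklore] -/
theorem card_V (θ : P.Theta) : P.n * P.n ≤ (P.V θ).card + 2 * P.k := by
  classical
  set badA : Finset (Fin P.n × Fin P.n) :=
    Finset.univ.filter fun v => ∃ j, (v.1 : ℕ) = P.a θ j ∧ (v.2 : ℕ) = P.a θ j with hbadA
  set badB : Finset (Fin P.n × Fin P.n) :=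
    Finset.univ.filter fun v => ∃ j, (v.1 : ℕ) = P.b θ j ∧ (v.2 : ℕ) = P.b θ j + 1 with hbadB
  have hsplit := Finset.card_filter_add_card_filter_not (s := (Finset.univ : Finset (Fin P.n × Fin P.n)))
    (fun v => (¬ ∃ j, (v.1 : ℕ) = P.a θ j ∧ (v.2 : ℕ) = P.a θ j) ∧
      ¬ ∃ j, (v.1 : ℕ) = P.b θ j ∧ (v.2 : ℕ) = P.b θ j + 1)
  rw [Finset.card_univ, Fintype.card_prod, Fintype.card_fin] at hsplit
  have hsub : (Finset.univ.filter fun v : Fin P.n × Fin P.n =>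
      ¬ ((¬ ∃ j, (v.1 : ℕ) = P.a θ j ∧ (v.2 : ℕ) = P.a θ j) ∧
        ¬ ∃ j, (v.1 : ℕ) = P.b θ j ∧ (v.2 : ℕ) = P.b θ j + 1)) ⊆ badA ∪ badB := by
    intro v hv
    rw [Finset.mem_filter] at hv
    rw [Finset.mem_union, hbadA, hbadB, Finset.mem_filter, Finset.mem_filter]
    tauto
  have hA : badA.card ≤ P.k := by
    calc badA.card ≤ (Finset.univ.image fun j => (P.colA θ j, P.colA θ j)).card := by
          refine Finset.card_le_card fun v hv => ?_
          rw [hbadA, Finset.mem_filter] at hv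
          obtain ⟨j, h1, h2⟩ := hv.2
          exact Finset.mem_image.2 ⟨j, Finset.mem_univ _, Prod.ext (Fin.ext h1.symm) (Fin.ext h2.symm)⟩
      _ ≤ P.k := Finset.card_image_le.trans (by simp)
  have hB : badB.card ≤ P.k := by
    have hinj : Set.InjOn Prod.fst (badB : Set (Fin P.n × Fin P.n)) := by
      intro v hv v' hv' h
      simp only [hbadB, Finset.coe_filter, Finset.mem_univ, true_and, Set.mem_setOf_eq] at hv hv'
      obtain ⟨j, h1, h2⟩ := hv
      obtain ⟨j', h1', h2'⟩ := hv'
      have hjj : j = j' := b_injective θ (by rw [← h1, ← h1']; exact congrArg Fin.val h)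
      subst hjj
      exact Prod.ext h (Fin.ext (by omega))
    have hsub' : badB.image Prod.fst ⊆ Finset.univ.image (P.rowB θ) := by
      intro r hr
      simp only [hbadB, Finset.mem_image, Finset.mem_filter, Finset.mem_univ, true_and] at hr ⊢
      obtain ⟨v, ⟨j, h1, -⟩, rfl⟩ := hr
      exact ⟨j, Fin.ext h1.symm⟩
    calc badB.card = (badB.image Prod.fst).card := (Finset.card_image_of_injOn hinj).symm
      _ ≤ (Finset.univ.image (P.rowB θ)).card := Finset.card_le_card hsub'
      _ ≤ P.k := Finset.card_image_le.trans (by simp)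
  have := (Finset.card_le_card hsub).trans (Finset.card_union_le _ _)
  change (P.V θ).card + _ = _ at hsplit
  omega

/-- `Q_θ` has no two adjacent positions (it is an increasing sequence). [folklore] -/
theorem PQ_succ (θ : P.Theta) (p : ℕ) (h : P.PQ θ p) : ¬ P.PQ θ (p + 1) := by
  rintro h'
  rcases h with ⟨-, -, ⟨h1, h2⟩ | ⟨h1, j, hj1, hj2⟩⟩ <;>
    rcases h' with ⟨-, -, ⟨h1', h2'⟩ | ⟨h1', j', hj1', hj2'⟩⟩
  · omega
  · exact h2 ⟨j', by omega, by omega⟩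
  · exact h2' ⟨j, by omega, by omega⟩
  · omega

/-- Positions of `Q_θ` are occupied by the pivot `γ + 1_{Q_θ}`. [folklore] -/
theorem U_of_PQ (θ : P.Theta) (γ : (Fin P.n × Fin P.n) →₀ ℕ) (p : ℕ) (h : P.PQ θ p) :
    P.U (P.piv θ γ) p := by
  have hr : p / 2 < P.n := h.1
  have hc : (p + 1) / 2 < P.n := h.2.1
  simp only [U, ext, hr, hc, and_self, dif_pos, piv, Finsupp.add_apply, mono_sigma0_apply]
  rw [if_pos (show P.InQ θ (p / 2) ((p + 1) / 2) from h)]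
  omega

/-- Positions occupied by a pivot with ADMISSIBLE shift are in `Q_θ ∪ (Q_θ + 1)`. [folklore] -/
theorem PQ_of_U (θ : P.Theta) (γ : (Fin P.n × Fin P.n) →₀ ℕ) (hγ : ∀ v, γ v ≠ 0 → v ∈ P.V θ)
    (p : ℕ) (h : P.U (P.piv θ γ) p) : P.PQ θ p ∨ (1 ≤ p ∧ P.PQ θ (p - 1)) := by
  simp only [U, ext] at h
  split_ifs at h with hb
  swap
  · exact absurd rfl h
  obtain ⟨hr, hc⟩ := hb
  simp only [piv, Finsupp.add_apply, mono_sigma0_apply] at h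
  by_cases hq : P.InQ θ (p / 2) ((p + 1) / 2)
  · exact Or.inl hq
  rw [if_neg hq, add_zero] at h
  have hv := hγ _ h
  simp only [V, Finset.mem_filter, Finset.mem_univ, true_and] at hv
  obtain ⟨hvA, hvB⟩ := hv
  rcases Nat.even_or_odd p with ⟨i, hi⟩ | ⟨i, hi⟩
  · -- diagonal cell `(i, i)`
    have h1 : p / 2 = i := by omega
    have h2 : (p + 1) / 2 = i := by omega
    simp only [h1, h2] at hq hvA hr
    by_cases hI : P.inIcc θ i
    · obtain ⟨j, hj1, hj2⟩ := hI
      have hne : i ≠ P.a θ j := fun he => hvA ⟨j, he, he⟩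
      have h3 : (p - 1) / 2 = i - 1 := by omega
      have h4 : (p - 1 + 1) / 2 = i := by omega
      refine Or.inr ⟨by omega, ?_⟩
      show P.InQ θ ((p - 1) / 2) ((p - 1 + 1) / 2)
      rw [h3, h4]
      exact ⟨by omega, hr, Or.inr ⟨by omega, j, by omega, by omega⟩⟩
    · exact absurd ⟨hr, hr, Or.inl ⟨rfl, hI⟩⟩ hq
  · -- super-diagonal cell `(i, i+1)`
    have h1 : p / 2 = i := by omega
    have h2 : (p + 1) / 2 = i + 1 := by omega
    simp only [h1, h2] at hq hvB hr hc
    by_cases hI : P.inIco θ i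
    · exact absurd ⟨hr, hc, Or.inr ⟨rfl, hI⟩⟩ hq
    · have h3 : (p - 1) / 2 = i := by omega
      have h4 : (p - 1 + 1) / 2 = i := by omega
      refine Or.inr ⟨by omega, ?_⟩
      show P.InQ θ ((p - 1) / 2) ((p - 1 + 1) / 2)
      rw [h3, h4]
      refine ⟨hr, hr, Or.inl ⟨rfl, ?_⟩⟩
      rintro ⟨j, hj1, hj2⟩
      rcases Nat.eq_or_lt_of_le hj2 with he | hlt
      · exact hvB ⟨j, he, by rw [he]⟩
      · exact hI ⟨j, hj1, hlt⟩

/-- **Decoding the pivot**: the greedy selection from the occupied positions of a pivot with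
admissible shift is exactly `Q_θ`. [folklore] -/
theorem greedy_piv (θ : P.Theta) (γ : (Fin P.n × Fin P.n) →₀ ℕ) (hγ : ∀ v, γ v ≠ 0 → v ∈ P.V θ)
    (p : ℕ) : greedy (P.U (P.piv θ γ)) p ↔ P.PQ θ p :=
  greedy_iff _ _ (U_of_PQ θ γ) (PQ_of_U θ γ hγ) (PQ_succ θ) p

/-- `Q_θ` on even positions: `(i,i) ∈ Q_θ ↔ i ∉ ⋃ [a_j, b_j]`. [folklore] -/
theorem PQ_two_mul (θ : P.Theta) {i : ℕ} (hi : i < P.n) : P.PQ θ (2 * i) ↔ ¬ P.inIcc θ i := by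
  have h1 : 2 * i / 2 = i := by omega
  have h2 : (2 * i + 1) / 2 = i := by omega
  unfold PQ InQ
  rw [h1, h2]
  constructor
  · rintro ⟨-, -, ⟨-, h⟩ | ⟨h, -⟩⟩
    · exact h
    · omega
  · exact fun h => ⟨hi, hi, Or.inl ⟨rfl, h⟩⟩

/-- **Pivots determine the member**: equal pivots with admissible shifts come from the same
`θ`. [folklore] -/
theorem theta_eq_of_piv_eq {θ θ' : P.Theta} {γ γ' : (Fin P.n × Fin P.n) →₀ ℕ}
    (hγ : ∀ v, γ v ≠ 0 → v ∈ P.V θ) (hγ' : ∀ v, γ' v ≠ 0 → v ∈ P.V θ')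
    (h : P.piv θ γ = P.piv θ' γ') : θ = θ' := by
  have hPQ : ∀ p, P.PQ θ p ↔ P.PQ θ' p := fun p =>
    (greedy_piv θ γ hγ p).symm.trans (h ▸ greedy_piv θ' γ' hγ' p)
  have hIcc : ∀ i, i < P.n → (P.inIcc θ i ↔ P.inIcc θ' i) := fun i hi => by
    have := (PQ_two_mul θ hi).symm.trans ((hPQ _).trans (PQ_two_mul θ' hi))
    tauto
  have hab : ∀ j, P.a θ j = P.a θ' j ∧ P.b θ j = P.b θ' j := by
    intro j
    have ha1 := a_lt_b θ j
    have ha2 := a_lt_b θ' j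
    obtain ⟨j1, h11, h12⟩ := (hIcc _ (a_lt_n θ j)).1 ⟨j, le_rfl, ha1.le⟩
    obtain ⟨j2, h21, h22⟩ := (hIcc _ (a_lt_n θ' j)).2 ⟨j, le_rfl, ha2.le⟩
    obtain ⟨j3, h31, h32⟩ := (hIcc _ (b_lt_n θ j)).1 ⟨j, ha1.le, le_rfl⟩
    obtain ⟨j4, h41, h42⟩ := (hIcc _ (b_lt_n θ' j)).2 ⟨j, ha2.le, le_rfl⟩
    have e1 : j1 = j := by
      rcases trich θ' θ j1 j with e | e | e
      · exact e
      · omega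
      · omega
    have e2 : j2 = j := by
      rcases trich θ θ' j2 j with e | e | e
      · exact e
      · omega
      · omega
    have e3 : j3 = j := by
      have := a_lt_b θ' j3
      rcases trich θ' θ j3 j with e | e | e
      · exact e
      · omega
      · omega
    have e4 : j4 = j := by
      have := a_lt_b θ j4
      rcases trich θ θ' j4 j with e | e | e
      · exact e
      · omega
      · omega
    subst e1; subst e2; subst e3; subst e4
    omega
  obtain ⟨u, v⟩ := θ
  obtain ⟨u', v'⟩ := θ'
  simp only [a, b, Prod.mk.injEq] at hab ⊢
  refine ⟨funext fun j => Fin.ext ?_, funext fun j => Fin.ext ?_⟩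
  · have := (hab j).1; omega
  · have := (hab j).2; omega

/-! ### §4e Linear independence of the shifted minors and the dimension lower bound -/

variable (P)

/-- An admissible shift (exponent vector on `V_θ`) as an exponent vector on all cells.
[folklore] -/
def emb (θ : P.Theta) (γ : (P.V θ) →₀ ℕ) : (Fin P.n × Fin P.n) →₀ ℕ :=
  Finsupp.mapDomain Subtype.val γ

/-- The index set of the shifted minors: a member `θ` and an admissible shift of degree `≤ ℓ`.
[folklore] -/
abbrev Idx (ℓ : ℕ) : Type := Σ θ : P.Theta, degLE (P.V θ) ℓ

/-- The shifted minors `x^γ ∂_θ f_c`. [folklore] -/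
def vec {K : Type*} [CommRing K] (c : Equiv.Perm (Fin P.n) → K) (ℓ : ℕ) (i : P.Idx ℓ) :
    MvPolynomial (Fin P.n × Fin P.n) K :=
  monomial (P.emb i.1 i.2) 1 * iterPderiv (P.dvars i.1) (P.fpoly c)

variable {P}

/-- `emb` is injective. [folklore] -/
theorem emb_injective (θ : P.Theta) : Function.Injective (P.emb θ) :=
  Finsupp.mapDomain_injective Subtype.val_injective

/-- `emb` preserves the degree. [folklore] -/
theorem degree_emb (θ : P.Theta) (γ : (P.V θ) →₀ ℕ) : (P.emb θ γ).degree = γ.degree :=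
  Finsupp.degree_mapDomain _ _

/-- `emb γ` is supported on `V_θ`. [folklore] -/
theorem mem_V_of_emb_ne (θ : P.Theta) (γ : (P.V θ) →₀ ℕ) (v : Fin P.n × Fin P.n)
    (hv : P.emb θ γ v ≠ 0) : v ∈ P.V θ := by
  classical
  have : v ∈ (P.emb θ γ).support := Finsupp.mem_support_iff.2 hv
  obtain ⟨w, -, rfl⟩ := Finset.mem_image.1 (Finsupp.mapDomain_support this)
  exact w.2

/-- **The shifted minors are linearly independent** (GKKS 2014, Cor. 12/13 with Lemma 14, in
the weight rendering): distinct indices have distinct pivots, each pivot is the unique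
maximal-weight monomial of its shifted minor. [cite: GuptaKamathKayalSaptharishi2014, Cor. 13] -/
theorem vec_linearIndependent {K : Type*} [Field K] (c : Equiv.Perm (Fin P.n) → K)
    (hc : ∀ σ, c σ ≠ 0) (ℓ : ℕ) : LinearIndependent K (P.vec c ℓ) := by
  refine linearIndependent_of_triangular (P.vec c ℓ)
    (fun i => lcoeff K (P.piv i.1 (P.emb i.1 i.2))) (fun i => P.wt (P.piv i.1 (P.emb i.1 i.2)))
    (fun i => ?_) (fun i j hij hle => ?_)
  · rw [lcoeff_apply, vec, coeff_piv_self]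
    exact hc _
  · rw [lcoeff_apply, vec]
    refine coeff_piv_other c (fun h => hij ?_) hle
    obtain ⟨θ, γ, hγ⟩ := i
    obtain ⟨θ', γ', hγ'⟩ := j
    have hθ : θ' = θ :=
      theta_eq_of_piv_eq (mem_V_of_emb_ne θ' γ') (mem_V_of_emb_ne θ γ) h
    subst hθ
    have hγγ : γ' = γ := emb_injective θ' (add_left_injective _ h)
    subst hγγ
    rfl

/-- **GKKS 2014, Cor. 16 (dimension lower bound, block-family rendering)**: for a
permanent-like `f_c` with all `c_σ ≠ 0`, the shifted-partials space along the block family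
has dimension `≥ h^{2k} · C(n² - 2k + ℓ, ℓ)`. [cite: GuptaKamathKayalSaptharishi2014, Cor. 16] -/
theorem finrank_shifted_ge {K : Type*} [Field K] (c : Equiv.Perm (Fin P.n) → K)
    (hc : ∀ σ, c σ ≠ 0) (ℓ : ℕ) :
    P.h ^ P.k * P.h ^ P.k * (P.n * P.n - 2 * P.k + ℓ).choose ℓ ≤
      Module.finrank K (shifted P.dvars ℓ (P.fpoly c)) := by
  classical
  have hli := vec_linearIndependent c hc ℓ
  have hle : Submodule.span K (Set.range (P.vec c ℓ)) ≤ shifted P.dvars ℓ (P.fpoly c) := by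
    refine Submodule.span_le.mpr ?_
    rintro _ ⟨⟨θ, γ⟩, rfl⟩
    refine Submodule.subset_span ⟨(θ, ⟨P.emb θ γ, ?_⟩), rfl⟩
    rw [mem_degLE, degree_emb]
    exact mem_degLE.1 γ.2
  haveI : Module.Finite K (shifted P.dvars ℓ (P.fpoly c)) :=
    Module.Finite.span_of_finite K (Set.finite_range _)
  calc P.h ^ P.k * P.h ^ P.k * (P.n * P.n - 2 * P.k + ℓ).choose ℓ
      = ∑ _θ : P.Theta, (P.n * P.n - 2 * P.k + ℓ).choose ℓ := by
        rw [Finset.sum_const, Finset.card_univ, smul_eq_mul, Fintype.card_prod, Fintype.card_fun,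
          Fintype.card_fin, Fintype.card_fin]
    _ ≤ ∑ θ : P.Theta, (degLE (P.V θ) ℓ).card := by
        refine Finset.sum_le_sum fun θ _ => ?_
        rw [card_degLE, Fintype.card_coe]
        have := card_V θ
        exact Nat.choose_le_choose _ (by omega)
    _ = Fintype.card (P.Idx ℓ) := by
        rw [Fintype.card_sigma]
        simp only [Fintype.card_coe]
    _ = Module.finrank K (Submodule.span K (Set.range (P.vec c ℓ))) :=
        (finrank_span_eq_card hli).symm
    _ ≤ Module.finrank K (shifted P.dvars ℓ (P.fpoly c)) := Submodule.finrank_mono hle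

end Blocks

/-! ## §5 Numerics (GKKS 2014, §6 with `ℓ = n²t`, `k = t/M`, `t = ⌊√n⌋`) -/

section Numerics

/-- `#{A ⊆ [D] : |A| ≤ k} ≤ C(D + k, k)` (pad `A` to size `k` with new elements; here via
Vandermonde's identity). [folklore] -/
theorem numSubsetsLE_le (D k : ℕ) : numSubsetsLE D k ≤ (D + k).choose k := by
  classical
  unfold numSubsetsLE
  calc ((Finset.univ : Finset (Finset (Fin D))).filter fun A => A.card ≤ k).card
      ≤ ((Finset.range (k + 1)).biUnion fun a =>
          Finset.powersetCard a (Finset.univ : Finset (Fin D))).card := by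
        refine Finset.card_le_card fun A hA => ?_
        rw [Finset.mem_filter] at hA
        exact Finset.mem_biUnion.2 ⟨A.card, Finset.mem_range.2 (by omega),
          Finset.mem_powersetCard.2 ⟨Finset.subset_univ _, rfl⟩⟩
    _ ≤ ∑ a ∈ Finset.range (k + 1),
          (Finset.powersetCard a (Finset.univ : Finset (Fin D))).card := Finset.card_biUnion_le
    _ = ∑ a ∈ Finset.range (k + 1), D.choose a := by simp [Finset.card_powersetCard]
    _ ≤ ∑ ij ∈ Finset.antidiagonal k, D.choose ij.1 * k.choose ij.2 := by
        rw [Finset.Nat.sum_antidiagonal_eq_sum_range_succ (fun i j => D.choose i * k.choose j) k]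
        refine Finset.sum_le_sum fun i _ => ?_
        exact Nat.le_mul_of_pos_right _ (Nat.choose_pos (Nat.sub_le _ _))
    _ = (D + k).choose k := (Nat.add_choose_eq D k k).symm

/-- Ratio estimate in the SHIFT parameter:
`C(N+ℓ+m, ℓ+m) ≤ C(N+ℓ, ℓ) · ((N+ℓ+1)/(ℓ+1))^m`. [folklore] -/
theorem choose_shift_le (N ℓ m : ℕ) :
    ((N + ℓ + m).choose (ℓ + m) : ℝ) ≤ (N + ℓ).choose ℓ * (((N + ℓ + 1 : ℕ) : ℝ) / (ℓ + 1 : ℕ)) ^ m := by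
  induction m with
  | zero => simp
  | succ m ih =>
    have hid : (((N + ℓ + (m + 1)).choose (ℓ + (m + 1)) : ℕ) : ℝ) =
        (N + ℓ + m).choose (ℓ + m) * ((((N + ℓ + m : ℕ) : ℝ) + 1) / (((ℓ + m : ℕ) : ℝ) + 1)) := by
      have h := Nat.add_one_mul_choose_eq (N + ℓ + m) (ℓ + m)
      rw [show N + ℓ + (m + 1) = N + ℓ + m + 1 by ring, show ℓ + (m + 1) = ℓ + m + 1 by ring]
      rw [mul_div_assoc', eq_div_iff (by positivity)]
      have h' : (((N + ℓ + m : ℕ) : ℝ) + 1) * ((N + ℓ + m).choose (ℓ + m) : ℕ) =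
          ((N + ℓ + m + 1).choose (ℓ + m + 1) : ℕ) * (((ℓ + m : ℕ) : ℝ) + 1) := by
        exact_mod_cast h
      linarith
    rw [hid, pow_succ, ← mul_assoc]
    refine mul_le_mul ih ?_ (by positivity) (by positivity)
    rw [div_le_div_iff₀ (by positivity) (by positivity)]
    push_cast
    nlinarith

/-- Ratio estimate in the number of VARIABLES:
`C(N'+d+ℓ, ℓ) ≤ C(N'+ℓ, ℓ) · ((N'+ℓ+1)/(N'+1))^d`. [folklore] -/
theorem choose_vars_le (N' ℓ d : ℕ) :
    ((N' + d + ℓ).choose ℓ : ℝ) ≤ (N' + ℓ).choose ℓ * (((N' + ℓ + 1 : ℕ) : ℝ) / (N' + 1 : ℕ)) ^ d := by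
  induction d with
  | zero => simp
  | succ d ih =>
    have hid : (((N' + (d + 1) + ℓ).choose ℓ : ℕ) : ℝ) =
        (N' + d + ℓ).choose ℓ * ((((N' + d + ℓ : ℕ) : ℝ) + 1) / (((N' + d : ℕ) : ℝ) + 1)) := by
      have h := Nat.choose_mul_succ_eq (N' + d + ℓ) ℓ
      rw [show N' + d + ℓ + 1 - ℓ = N' + d + 1 by omega] at h
      rw [show N' + (d + 1) + ℓ = N' + d + ℓ + 1 by ring]
      rw [mul_div_assoc', eq_div_iff (by positivity)]
      have h' : (((N' + d + ℓ).choose ℓ : ℕ) : ℝ) * (((N' + d + ℓ : ℕ) : ℝ) + 1) =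
          ((N' + d + ℓ + 1).choose ℓ : ℕ) * (((N' + d : ℕ) : ℝ) + 1) := by
        exact_mod_cast h
      linarith
    rw [hid, pow_succ, ← mul_assoc]
    refine mul_le_mul ih ?_ (by positivity) (by positivity)
    rw [div_le_div_iff₀ (by positivity) (by positivity)]
    push_cast
    nlinarith

/-- `(1 + 1/t)^t ≤ 3` (`≤ e`). [folklore] -/
theorem one_add_inv_pow_le_three (t : ℕ) : ((1 : ℝ) + 1 / (t : ℝ)) ^ t ≤ 3 := by
  rcases Nat.eq_zero_or_pos t with rfl | ht
  · simp
  have h1 : (1 : ℝ) + 1 / t ≤ Real.exp (1 / t) := by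
    have := Real.add_one_le_exp (1 / (t : ℝ)); linarith
  have htpos : (0 : ℝ) < t := by exact_mod_cast ht
  calc ((1 : ℝ) + 1 / t) ^ t ≤ (Real.exp (1 / t)) ^ t := pow_le_pow_left₀ (by positivity) h1 t
    _ = Real.exp 1 := by rw [← Real.exp_nat_mul]; congr 1; field_simp
    _ ≤ 3 := by have := Real.exp_one_lt_d9; linarith

/-- `(k/3)^k ≤ k!`. [folklore] -/
theorem pow_div_three_le_factorial (k : ℕ) : ((k : ℝ) / 3) ^ k ≤ (k.factorial : ℝ) := by
  induction k with
  | zero => simp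
  | succ k ih =>
    rw [Nat.factorial_succ, Nat.cast_mul]
    have h3 : ((((k + 1 : ℕ) : ℝ)) / 3) ^ (k + 1) ≤ ((k + 1 : ℕ) : ℝ) * ((k : ℝ) / 3) ^ k := by
      rcases Nat.eq_zero_or_pos k with rfl | hk
      · norm_num
      have hk' : (0 : ℝ) < k := by exact_mod_cast hk
      have key : ((((k + 1 : ℕ) : ℝ)) / 3) ^ k ≤ 3 * ((k : ℝ) / 3) ^ k := by
        have := one_add_inv_pow_le_three k
        calc ((((k + 1 : ℕ) : ℝ)) / 3) ^ k = ((k : ℝ) / 3) ^ k * ((1 : ℝ) + 1 / k) ^ k := by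
              rw [← mul_pow]; congr 1; push_cast; field_simp
          _ ≤ ((k : ℝ) / 3) ^ k * 3 := by gcongr
          _ = 3 * ((k : ℝ) / 3) ^ k := by ring
      calc ((((k + 1 : ℕ) : ℝ)) / 3) ^ (k + 1)
          = (((k + 1 : ℕ) : ℝ)) / 3 * (((((k + 1 : ℕ) : ℝ)) / 3) ^ k) := by ring
        _ ≤ (((k + 1 : ℕ) : ℝ)) / 3 * (3 * ((k : ℝ) / 3) ^ k) := by gcongr
        _ = ((k + 1 : ℕ) : ℝ) * ((k : ℝ) / 3) ^ k := by ring
    calc ((((k + 1 : ℕ) : ℝ)) / 3) ^ (k + 1) ≤ ((k + 1 : ℕ) : ℝ) * ((k : ℝ) / 3) ^ k := h3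
      _ ≤ ((k + 1 : ℕ) : ℝ) * (k.factorial : ℝ) := by gcongr

/-- **The numerical heart of GKKS 2014, Thm. 2** (their §6 / Claim 17, in elementary form).
With `M' ≥ 1300(c₀+1)`, `t = ⌊√n⌋`, `k = ⌊t/(2M')⌋`, `h ≥ tM'`, `ℓ = n²t`, `D = c₀ t`: if
`h^{2k} C(n²-2k+ℓ, ℓ) ≤ s · #{A ⊆ [D], |A| ≤ k} · C(n²+ℓ+k(t-1), ℓ+k(t-1))` and `n ≥ 16M'²`,
then `2^{√n/(2M')} ≤ s`. [cite: GuptaKamathKayalSaptharishi2014, §6] -/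
theorem numeric (c₀ n s hh M' : ℕ) (hM'ge : 1300 * (c₀ + 1) ≤ M') (hn : 4 * (2 * M') ^ 2 ≤ n)
    (hhh : Nat.sqrt n * M' ≤ hh)
    (hineq : hh ^ (Nat.sqrt n / (2 * M')) * hh ^ (Nat.sqrt n / (2 * M')) *
        (n * n - 2 * (Nat.sqrt n / (2 * M')) + n * n * Nat.sqrt n).choose
          (n * n * Nat.sqrt n) ≤
      s * numSubsetsLE (c₀ * Nat.sqrt n) (Nat.sqrt n / (2 * M')) *
        (n * n + (n * n * Nat.sqrt n + Nat.sqrt n / (2 * M') * (Nat.sqrt n - 1))).choose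
          (n * n * Nat.sqrt n + Nat.sqrt n / (2 * M') * (Nat.sqrt n - 1))) :
    (2 : ℝ) ^ ((1 / (2 * M' : ℕ) : ℝ) * Real.sqrt n) ≤ s := by
  -- names: `t = ⌊√n⌋`, `kk = ⌊t / 2M'⌋`, `N = n²` (generalized, to keep arithmetic opaque)
  have htn0 := Nat.sqrt_le n
  have hnt0 := Nat.lt_succ_sqrt n
  have htle0 := Nat.sqrt_le_self n
  revert hhh hineq htn0 hnt0 htle0
  generalize Nat.sqrt n = t
  intro hhh hineq htn hnt0 htle
  have hnt : n < (t + 1) * (t + 1) := hnt0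
  clear hnt0
  have hkkM0 := Nat.div_mul_le_self t (2 * M')
  have hkkdm := Nat.div_add_mod' t (2 * M')
  have hmod := Nat.mod_lt t (by omega : 0 < 2 * M')
  revert hhh hineq hkkM0 hkkdm hmod
  generalize t / (2 * M') = kk
  intro hhh hineq hkkM hkkdm hmod
  have hN0 : n ≤ n * n := Nat.le_mul_self n
  revert hineq hN0
  generalize n * n = N
  intro hineq hN1
  revert hineq
  -- basic natural-number facts
  have hMpos : 0 < M' := by omega
  have ht2M : 2 * (2 * M') ≤ t := by
    by_contra hlt
    push Not at hlt
    have h1 : (t + 1) * (t + 1) ≤ (4 * M') * (4 * M') := Nat.mul_le_mul (by omega) (by omega)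
    have h2 : 4 * (2 * M') ^ 2 = (4 * M') * (4 * M') := by ring
    omega
  have ht1 : 1 ≤ t := by omega
  have htkk : t < kk * (2 * M') + 2 * M' := by omega
  have hkk1 : 2 ≤ kk := by
    by_contra hlt
    push Not at hlt
    have : kk * (2 * M') ≤ 1 * (2 * M') := Nat.mul_le_mul_right _ (by omega)
    omega
  have hn1 : 1 ≤ n := by nlinarith
  have h4kk : 4 * kk ≤ N := by
    have h1 : kk * 4 ≤ kk * (2 * M') := Nat.mul_le_mul_left kk (by omega)
    omega
  have hmle : kk * (t - 1) ≤ kk * t := Nat.mul_le_mul_left _ (Nat.sub_le _ _)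
  -- real-number facts
  have htR : (1 : ℝ) ≤ t := by exact_mod_cast ht1
  have htpos : (0 : ℝ) < t := by linarith
  have hkkpos : (0 : ℝ) < kk := by exact_mod_cast (by omega : 0 < kk)
  have hkkR : (4 : ℝ) * kk ≤ N := by exact_mod_cast h4kk
  have hNR : (1 : ℝ) ≤ N := by exact_mod_cast (hn1.trans hN1)
  have hM'R : (0 : ℝ) < M' := by exact_mod_cast hMpos
  -- (R1) the shift ratio `Y = (N + ℓ + 1)/(ℓ + 1) ≤ 1 + 1/t`, `Y^{k(t-1)} ≤ 3^k`
  have hY1 : (1 : ℝ) ≤ ((N + N * t + 1 : ℕ) : ℝ) / (N * t + 1 : ℕ) := by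
    rw [le_div_iff₀ (by positivity), one_mul]
    exact_mod_cast (by omega : N * t + 1 ≤ N + N * t + 1)
  have hY : (((N + N * t + 1 : ℕ) : ℝ) / (N * t + 1 : ℕ)) ≤ 1 + 1 / t := by
    rw [div_le_iff₀ (by positivity)]
    push_cast
    have e : ((1 : ℝ) + 1 / t) * (N * t + 1) = N * t + 1 + N + 1 / t := by
      field_simp
      ring
    rw [e]
    have : (0 : ℝ) ≤ 1 / t := by positivity
    linarith
  have hYm : (((N + N * t + 1 : ℕ) : ℝ) / (N * t + 1 : ℕ)) ^ (kk * (t - 1)) ≤ 3 ^ kk := by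
    calc (((N + N * t + 1 : ℕ) : ℝ) / (N * t + 1 : ℕ)) ^ (kk * (t - 1))
        ≤ (((N + N * t + 1 : ℕ) : ℝ) / (N * t + 1 : ℕ)) ^ (kk * t) := pow_le_pow_right₀ hY1 hmle
      _ ≤ (1 + 1 / (t : ℝ)) ^ (kk * t) := pow_le_pow_left₀ (by positivity) hY _
      _ = ((1 + 1 / (t : ℝ)) ^ t) ^ kk := by rw [← pow_mul, mul_comm]
      _ ≤ 3 ^ kk := pow_le_pow_left₀ (by positivity) (one_add_inv_pow_le_three t) kk
  -- (R2) the variables ratio `X = (N - 2k + ℓ + 1)/(N - 2k + 1) ≤ 3t`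
  have hX : (((N - 2 * kk + N * t + 1 : ℕ) : ℝ) / (N - 2 * kk + 1 : ℕ)) ≤ 3 * t := by
    rw [div_le_iff₀ (by positivity)]
    have h1 : ((N - 2 * kk : ℕ) : ℝ) = N - 2 * kk := by
      rw [Nat.cast_sub (by omega)]; push_cast; ring
    push_cast
    rw [h1]
    nlinarith [mul_nonneg (sub_nonneg.2 hkkR) (by linarith : (0:ℝ) ≤ 2 * t - 1),
      mul_nonneg hkkpos.le (sub_nonneg.2 htR)]
  have hXpow : (((N - 2 * kk + N * t + 1 : ℕ) : ℝ) / (N - 2 * kk + 1 : ℕ)) ^ (2 * kk) ≤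
      (3 * t) ^ (2 * kk) := pow_le_pow_left₀ (by positivity) hX _
  -- the count of subsets: `#{A} ≤ C(D + k, k) ≤ (3(D+k)/k)^k ≤ (12M'(c₀+1))^k`
  have hA : (numSubsetsLE (c₀ * t) kk : ℝ) ≤ ((12 * M' * (c₀ + 1) : ℕ) : ℝ) ^ kk := by
    have h1 : (numSubsetsLE (c₀ * t) kk : ℝ) ≤ ((c₀ * t + kk).choose kk : ℕ) := by
      exact_mod_cast numSubsetsLE_le (c₀ * t) kk
    have h2 : (((c₀ * t + kk).choose kk : ℕ) : ℝ) ≤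
        ((c₀ * t + kk : ℕ) : ℝ) ^ kk / (kk.factorial : ℝ) := by
      have h := Nat.choose_le_pow_div (α := ℝ) kk (c₀ * t + kk)
      push_cast at h ⊢
      exact h
    have hpowpos : (0 : ℝ) < ((kk : ℝ) / 3) ^ kk := pow_pos (by positivity) kk
    have h3 : ((c₀ * t + kk : ℕ) : ℝ) ^ kk / (kk.factorial : ℝ) ≤
        ((c₀ * t + kk : ℕ) : ℝ) ^ kk / ((kk : ℝ) / 3) ^ kk :=
      div_le_div_of_nonneg_left (by positivity) hpowpos (pow_div_three_le_factorial kk)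
    have h4 : ((c₀ * t + kk : ℕ) : ℝ) ^ kk / ((kk : ℝ) / 3) ^ kk =
        (3 * ((c₀ * t + kk : ℕ) : ℝ) / kk) ^ kk := by
      rw [← div_pow]; congr 1; field_simp
    have h5 : 3 * ((c₀ * t + kk : ℕ) : ℝ) / kk ≤ ((12 * M' * (c₀ + 1) : ℕ) : ℝ) := by
      rw [div_le_iff₀ hkkpos]
      have hDR : ((c₀ * t : ℕ) : ℝ) ≤ c₀ * (2 * (kk * (2 * M'))) := by
        have : c₀ * t ≤ c₀ * (2 * (kk * (2 * M'))) := Nat.mul_le_mul_left _ (by omega)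
        exact_mod_cast this
      have hM1 : (1 : ℝ) ≤ M' := by exact_mod_cast hMpos
      have hc0 : (0 : ℝ) ≤ c₀ := Nat.cast_nonneg _
      push_cast at hDR ⊢
      nlinarith [mul_nonneg hc0 hkkpos.le, mul_nonneg (mul_nonneg hc0 hkkpos.le) (sub_nonneg.2 hM1),
        mul_nonneg hkkpos.le (sub_nonneg.2 hM1)]
    calc (numSubsetsLE (c₀ * t) kk : ℝ)
        ≤ ((c₀ * t + kk : ℕ) : ℝ) ^ kk / ((kk : ℝ) / 3) ^ kk := h1.trans (h2.trans h3)
      _ = (3 * ((c₀ * t + kk : ℕ) : ℝ) / kk) ^ kk := h4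
      _ ≤ ((12 * M' * (c₀ + 1) : ℕ) : ℝ) ^ kk := pow_le_pow_left₀ (by positivity) h5 kk
  have hC1pos : (0 : ℝ) < ((N - 2 * kk + N * t).choose (N * t) : ℕ) := by
    exact_mod_cast Nat.choose_pos (by omega)
  have hR1 := choose_shift_le N (N * t) (kk * (t - 1))
  have hR2 := choose_vars_le (N - 2 * kk) (N * t) (2 * kk)
  rw [show N - 2 * kk + 2 * kk = N by omega] at hR2
  have hBpos : (0 : ℝ) < ((27 * (12 * M' * (c₀ + 1)) : ℕ) : ℝ) := by
    have : 0 < 27 * (12 * M' * (c₀ + 1)) :=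
      Nat.mul_pos (by norm_num) (Nat.mul_pos (Nat.mul_pos (by norm_num) hMpos) (Nat.succ_pos _))
    exact_mod_cast this
  -- now the main chain
  intro hineq
  have hcast : ((hh : ℝ) ^ kk * hh ^ kk) * ((N - 2 * kk + N * t).choose (N * t) : ℕ) ≤
      (s : ℝ) * (numSubsetsLE (c₀ * t) kk : ℕ) *
        ((N + (N * t + kk * (t - 1))).choose (N * t + kk * (t - 1)) : ℕ) := by
    exact_mod_cast hineq
  clear hineq
  rw [← pow_add, ← two_mul, show N + (N * t + kk * (t - 1)) = N + N * t + kk * (t - 1) by ring]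
    at hcast
  have hmain : ((hh : ℝ) ^ (2 * kk)) * ((N - 2 * kk + N * t).choose (N * t) : ℕ) ≤
      (s * (((12 * M' * (c₀ + 1) : ℕ) : ℝ) ^ kk * (3 * t) ^ (2 * kk) * 3 ^ kk)) *
        ((N - 2 * kk + N * t).choose (N * t) : ℕ) := by
    calc ((hh : ℝ) ^ (2 * kk)) * ((N - 2 * kk + N * t).choose (N * t) : ℕ)
        ≤ (s : ℝ) * (numSubsetsLE (c₀ * t) kk : ℕ) *
          ((N + N * t + kk * (t - 1)).choose (N * t + kk * (t - 1)) : ℕ) := hcast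
      _ ≤ (s : ℝ) * ((12 * M' * (c₀ + 1) : ℕ) : ℝ) ^ kk *
          (((N + N * t).choose (N * t) : ℕ) *
            (((N + N * t + 1 : ℕ) : ℝ) / (N * t + 1 : ℕ)) ^ (kk * (t - 1))) := by
          gcongr
      _ ≤ (s : ℝ) * ((12 * M' * (c₀ + 1) : ℕ) : ℝ) ^ kk *
          ((((N - 2 * kk + N * t).choose (N * t) : ℕ) *
            (((N - 2 * kk + N * t + 1 : ℕ) : ℝ) / (N - 2 * kk + 1 : ℕ)) ^ (2 * kk)) *
              3 ^ kk) := by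
          gcongr
      _ ≤ (s : ℝ) * ((12 * M' * (c₀ + 1) : ℕ) : ℝ) ^ kk *
          ((((N - 2 * kk + N * t).choose (N * t) : ℕ) : ℝ) * (3 * t) ^ (2 * kk) * 3 ^ kk) := by
          gcongr
      _ = (s * (((12 * M' * (c₀ + 1) : ℕ) : ℝ) ^ kk * (3 * t) ^ (2 * kk) * 3 ^ kk)) *
          ((N - 2 * kk + N * t).choose (N * t) : ℕ) := by ring
  have hmain' : ((hh : ℝ) ^ (2 * kk)) ≤
      s * (((12 * M' * (c₀ + 1) : ℕ) : ℝ) ^ kk * (3 * t) ^ (2 * kk) * 3 ^ kk) :=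
    le_of_mul_le_mul_right hmain hC1pos
  -- lower bound on `hh`
  have hhR : ((t : ℝ) * M') ^ (2 * kk) ≤ (hh : ℝ) ^ (2 * kk) := by
    refine pow_le_pow_left₀ (by positivity) ?_ _
    exact_mod_cast hhh
  -- combine: `(M'^2)^kk ≤ s · (27·12 M' (c₀+1))^kk`
  have hfin : ((M' : ℝ) ^ 2) ^ kk ≤ s * (((27 * (12 * M' * (c₀ + 1)) : ℕ) : ℝ)) ^ kk := by
    have h1 := hhR.trans hmain'
    have eL : ((t : ℝ) * M') ^ (2 * kk) = ((t : ℝ) ^ 2) ^ kk * ((M' : ℝ) ^ 2) ^ kk := by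
      rw [pow_mul, mul_pow, mul_pow]
    have eR : (((12 * M' * (c₀ + 1) : ℕ) : ℝ) ^ kk * (3 * (t : ℝ)) ^ (2 * kk) * 3 ^ kk) =
        ((t : ℝ) ^ 2) ^ kk * (((27 * (12 * M' * (c₀ + 1)) : ℕ) : ℝ)) ^ kk := by
      rw [pow_mul, ← mul_pow, ← mul_pow, ← mul_pow]
      congr 1
      push_cast
      ring
    rw [eL, eR, ← mul_assoc, mul_comm (s : ℝ), mul_assoc] at h1
    exact le_of_mul_le_mul_left h1 (pow_pos (pow_pos htpos 2) kk)
  -- hence `4^kk ≤ s`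
  have h4 : (4 : ℝ) ^ kk ≤ s := by
    have h1 : ((4 : ℝ) * (((27 * (12 * M' * (c₀ + 1)) : ℕ) : ℝ))) ^ kk ≤ ((M' : ℝ) ^ 2) ^ kk := by
      refine pow_le_pow_left₀ (by positivity) ?_ _
      have hge : (1300 : ℝ) * (c₀ + 1) ≤ M' := by exact_mod_cast hM'ge
      have hc0 : (0 : ℝ) ≤ c₀ := Nat.cast_nonneg _
      push_cast
      nlinarith [mul_le_mul_of_nonneg_right hge hM'R.le]
    rw [mul_pow] at h1
    exact le_of_mul_le_mul_right (h1.trans hfin) (pow_pos hBpos kk)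
  -- and `2^{√n/(2M')} ≤ 4^kk`
  have hsqrt : Real.sqrt n < t + 1 := by
    rw [Real.sqrt_lt' (by positivity)]
    exact_mod_cast (by nlinarith : n < (t + 1) ^ 2)
  have hexp : (1 / (2 * M' : ℕ) : ℝ) * Real.sqrt n ≤ ((2 * kk : ℕ) : ℝ) := by
    have hMR : (0 : ℝ) < ((2 * M' : ℕ) : ℝ) := by positivity
    rw [one_div, inv_mul_le_iff₀ hMR]
    have : ((t : ℝ) + 1) ≤ ((2 * M' : ℕ) : ℝ) * ((2 * kk : ℕ) : ℝ) := by
      have : t + 1 ≤ (2 * M') * (2 * kk) := by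
        rw [show (2 * M') * (2 * kk) = 2 * (kk * (2 * M')) by ring]; omega
      exact_mod_cast this
    linarith
  calc (2 : ℝ) ^ ((1 / (2 * M' : ℕ) : ℝ) * Real.sqrt n)
      ≤ (2 : ℝ) ^ (((2 * kk : ℕ) : ℝ)) := Real.rpow_le_rpow_of_exponent_le (by norm_num) hexp
    _ = (4 : ℝ) ^ kk := by rw [Real.rpow_natCast, pow_mul]; norm_num
    _ ≤ s := h4

end Numerics

/-! ## §6 Assembly -/

section Assembly

variable {K : Type*} [Field K]

/-- `∏_i X_{σ i, i} = x^{1_σ}`. [folklore] -/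
theorem prod_X_eq_monomial (P : Blocks) (σ : Equiv.Perm (Fin P.n)) :
    (∏ i, X (σ i, i) : MvPolynomial (Fin P.n × Fin P.n) K) = monomial (P.mono Finset.univ σ) 1 := by
  rw [Blocks.mono, monomial_sum_one]
  rfl

/-- The permanent is the permanent-like polynomial with `c = 1`. [folklore] -/
theorem fpoly_one (P : Blocks) : P.fpoly (fun _ => (1 : K)) = perPoly (Fin P.n) K := by
  rw [perPoly, Matrix.permanent, Blocks.fpoly]
  refine Finset.sum_congr rfl fun σ _ => ?_
  rw [← prod_X_eq_monomial]
  rfl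

/-- The determinant is the permanent-like polynomial with `c = sign`. [folklore] -/
theorem fpoly_sign (P : Blocks) :
    P.fpoly (fun σ => ((Equiv.Perm.sign σ : ℤ) : K)) = detPoly (Fin P.n) K := by
  rw [detPoly, Matrix.det_apply', Blocks.fpoly]
  refine Finset.sum_congr rfl fun σ _ => ?_
  have : (∏ i, Matrix.mvPolynomialX (Fin P.n) (Fin P.n) K (σ i) i) =
      monomial (P.mono Finset.univ σ) (1 : K) := by
    rw [← prod_X_eq_monomial]; rfl
  rw [this, ← map_intCast (C : K →+* MvPolynomial (Fin P.n × Fin P.n) K), C_mul_monomial, mul_one]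

/-- **The dimension sandwich** for one member of `{per_n, det_n}`: if `f_c = ∑_{i<s} ∏_{j<D} Q_{ij}`
with `deg Q_{ij} ≤ t`, then `h^{2k} C(n²-2k+ℓ, ℓ) ≤ s · #{A} · C(n²+ℓ+k(t-1), ℓ+k(t-1))`.
[cite: GuptaKamathKayalSaptharishi2014, Thm. 2] -/
theorem sandwich (P : Blocks) (c : Equiv.Perm (Fin P.n) → K) (hc : ∀ σ, c σ ≠ 0) {s D t : ℕ}
    (hf : HasSPSPExpr (P.fpoly c) s D t) (ℓ : ℕ) :
    P.h ^ P.k * P.h ^ P.k * (P.n * P.n - 2 * P.k + ℓ).choose ℓ ≤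
      s * numSubsetsLE D P.k * (P.n * P.n + (ℓ + P.k * (t - 1))).choose (ℓ + P.k * (t - 1)) := by
  classical
  obtain ⟨Q, hQ, hfQ⟩ := hf
  have h1 := Blocks.finrank_shifted_ge (P := P) c hc ℓ
  have h2 := finrank_shifted_le (K := K) P.dvars P.k Blocks.length_dvars Q hQ (ℓ := ℓ)
  rw [← hfQ, card_degLE, Fintype.card_prod, Fintype.card_fin] at h2
  exact h1.trans h2

end Assembly

end Literature.Computability.AlgebraicComplexity.GKKS

namespace Literature.Computability.AlgebraicComplexity

open GKKS

/-- **Discharge of `gkks_depth4` (Gupta–Kamath–Kayal–Saptharishi 2014, Thm. 2, the case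
`t = ⌊√n⌋`)**: for every field (of any characteristic) and every `c₀`, with
`M = 2600(c₀+1)`, `ε = 1/M` and `n₀ = 4M²`, every `ΣΠ^{[c₀⌊√n⌋]}ΣΠ^{[⌊√n⌋]}` expression of
`per_n` or `det_n`, `n ≥ n₀`, has top fan-in `s ≥ 2^{ε√n}`. [cite: GuptaKamathKayalSaptharishi2014, Thm. 2] -/
theorem gkks_depth4_holds : gkks_depth4 := by
  intro K _ _ c₀
  -- `M' = 1300 (c₀ + 1)`, kept opaque (large numerals must not be unfolded by `whnf`)
  obtain ⟨M', hM'def⟩ : ∃ M' : ℕ, M' = 1300 * (c₀ + 1) := ⟨_, rfl⟩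
  have hM'ge : 1300 * (c₀ + 1) ≤ M' := hM'def.ge
  have hMpos : 0 < 2 * M' := by omega
  refine ⟨1 / ((2 * M' : ℕ) : ℝ), 4 * (2 * M') ^ 2, by positivity, ?_⟩
  intro n hn s hexpr
  -- the block family with `k = ⌊√n / 2M'⌋` blocks of length `L = ⌊n/k⌋`, `h = ⌊L/2⌋`
  have hkkM : Nat.sqrt n / (2 * M') * (2 * M') ≤ Nat.sqrt n := Nat.div_mul_le_self _ _
  have ht2M : 2 * (2 * M') ≤ Nat.sqrt n := by
    rw [Nat.le_sqrt]
    calc 2 * (2 * M') * (2 * (2 * M')) = 4 * (2 * M') ^ 2 := by ring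
      _ ≤ n := hn
  have hkk1 : 1 ≤ Nat.sqrt n / (2 * M') := by
    rw [Nat.le_div_iff_mul_le hMpos]; omega
  let P : Blocks :=
    { n := n, k := Nat.sqrt n / (2 * M'), L := n / (Nat.sqrt n / (2 * M'))
      h := n / (Nat.sqrt n / (2 * M')) / 2
      two_h_le := Nat.mul_div_le _ 2
      kL_le := Nat.mul_div_le n _ }
  -- `h ≥ ⌊√n⌋ · M'`
  have hhh : Nat.sqrt n * M' ≤ P.h := by
    show Nat.sqrt n * M' ≤ n / (Nat.sqrt n / (2 * M')) / 2
    have h1 : Nat.sqrt n * (2 * M') ≤ n / (Nat.sqrt n / (2 * M')) := by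
      rw [Nat.le_div_iff_mul_le (by omega)]
      calc Nat.sqrt n * (2 * M') * (Nat.sqrt n / (2 * M'))
          = Nat.sqrt n * (Nat.sqrt n / (2 * M') * (2 * M')) := by ring
        _ ≤ Nat.sqrt n * Nat.sqrt n := Nat.mul_le_mul_left _ hkkM
        _ ≤ n := Nat.sqrt_le n
    calc Nat.sqrt n * M' = Nat.sqrt n * (2 * M') / 2 := by
          rw [show Nat.sqrt n * (2 * M') = Nat.sqrt n * M' * 2 by ring, Nat.mul_div_cancel _ two_pos]
      _ ≤ n / (Nat.sqrt n / (2 * M')) / 2 := Nat.div_le_div_right h1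
  -- the dimension sandwich for `per` or `det`
  have key : P.h ^ P.k * P.h ^ P.k *
      (P.n * P.n - 2 * P.k + n * n * Nat.sqrt n).choose (n * n * Nat.sqrt n) ≤
      s * numSubsetsLE (c₀ * Nat.sqrt n) P.k *
        (P.n * P.n + (n * n * Nat.sqrt n + P.k * (Nat.sqrt n - 1))).choose
          (n * n * Nat.sqrt n + P.k * (Nat.sqrt n - 1)) := by
    rcases hexpr with hper | hdet
    · refine sandwich P (fun _ => (1 : K)) (fun _ => one_ne_zero) ?_ (n * n * Nat.sqrt n)
      rw [fpoly_one]; exact hper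
    · refine sandwich P (fun σ => ((Equiv.Perm.sign σ : ℤ) : K)) (fun σ => ?_) ?_
        (n * n * Nat.sqrt n)
      · rcases Int.units_eq_one_or (Equiv.Perm.sign σ) with h | h <;> simp [h]
      · rw [fpoly_sign]; exact hdet
  exact numeric c₀ n s P.h M' hM'ge hn hhh key

end Literature.Computability.AlgebraicComplexity
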